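import Mathlib.Analysis.Calculus.ContDiff.Convolution
import Literature.Analysis.FluidPDE.NewtonPotential
import Literature.Analysis.FluidPDE.HessianLaplacian
import Literature.Analysis.UnboundedOperators.HeatKernel
import Literature.Analysis.FluidPDE.LerayHopfSpatialGradient
import Literature.Analysis.FluidPDE.TaoEnergyLocalisationPressure
import Literature.Analysis.FluidPDE.SolenoidalTruncation
import HarnessLib

/-!
# The `L²` bound for the normalised pressure: discharge of `NS.stein1970_normalisedPressure_eLpNorm_le`

Fourth and last layer of the discharge of `NS.tao_finite_energy_smooth_energy_bound` (Tao 2011 =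
arXiv:1108.1165, **Lemma 8.1**). Layer 3 (`TaoEnergyLocalisationPressure`) reduced the fact to
Tao's pressure normalisation (`NS.tao_pressure_normalisation`, Lemma 4.1 (i)), the existence of
the principal values (`NS.hasPressurePV_of_contDiff`) and the `L²` boundedness of the Riesz-type
singular integral behind the normalised pressure, vendored there as the named fact
`NS.stein1970_normalisedPressure_eLpNorm_le` (Stein 1970, Ch. II §4.2 Thm 3):
`∃ C, ∀ w ∈ C^∞_c(ℝ³; ℝ³), p̃[w] ∈ L² ∧ ‖p̃[w]‖_{L²} ≤ C ‖|w|²‖_{L²}`. This file PROVES that fact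
(`stein1970_normalisedPressure_eLpNorm_le_holds`, `C = 27 M_λ`), whence

  `tao_finite_energy_smooth_energy_bound_of_pv :
     tao_pressure_normalisation → hasPressurePV_of_contDiff → tao_finite_energy_smooth_energy_bound`.

Mathlib (this pin) has no Calderón–Zygmund theory, no Riesz transforms and no `L²` Fourier
multiplier calculus for principal-value kernels, so we do not follow Stein's proof; instead we use
the Newtonian potential (`Δ⁻¹ = Γ *`, `Γ = -1/(4π|z|)`, the tree's `NS.newtonKernel`) and the
elementary identity `Σᵢⱼ‖∂ᵢ∂ⱼG‖²_{L²} = ‖ΔG‖²_{L²}` (`FluidPDE/HessianLaplacian`), which gives the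
sharp constant `A₂ = 1` for `∂ᵢ∂ⱼΔ⁻¹` (Stein 1970, Ch. III §1.3; Gilbarg–Trudinger (9.27)).

## The argument

* §1–§2. **Regularised kernel.** `Φ_ε(z) = ε⁻¹Γ∞(z/ε) = Γ∞^{ε/2,ε}(z)` with `Γ∞ = (1-θ)Γ` the
  tree's smooth far-field kernel `NS.newtonFar` (`FluidPDE/NewtonKernel`, scaling law
  `NewtonPotential.newtonFar_scale`): `Φ_ε ∈ C^∞`, `Φ_ε = Γ` for `|z| ≥ ε`, `|Φ_ε| ≤ (4π|z|)⁻¹`,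
  `‖D²Φ_ε‖ ≤ Mε⁻³`, `∂ₐ∂ₐΦ_ε = -K(·)(a)` for `|z| > ε` (`K` the pressure kernel),
  `ΔΦ_ε = λ^{ε/2,ε}` supported in `|z| ≤ ε` with `∫|ΔΦ_ε| = M_λ := ∫|λ^{1/2,1}|`, and the
  **isotropy** `∫_{|z|≤ε} ∂ₐ∂ₐΦ_ε = |a|²/3` — all from the tree's `FluidPDE/NewtonPotential`
  (`∫λ = 1`, `setIntegral_fderiv2_newtonFar_apply_self`, the scaling lemmas).
* §3. **`L²` bound for `H^a_ε[h] = ∫ h(t)∂ₐ∂ₐΦ_ε(· - t)dt`, `h ∈ C_c`:**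
  `‖H^a_ε[h]‖_{L²} ≤ |a|² M_λ ‖h‖_{L²}`. Truncate also at infinity, `Ψ = Φ_ε χ_R`
  (`χ_R = Fluid.cutoff R`); `G = h * Ψ ∈ C^∞_c` with `∂ₐ∂ₐG = h * ∂ₐ∂ₐΨ`, `ΔG = h * ΔΨ`
  (Mathlib's `HasCompactSupport.hasFDerivAt_convolution_right`), so
  `‖∂ₐ∂ₐG‖_{L²} ≤ |a|²‖ΔG‖_{L²}` (Hessian–Laplacian); `ΔΨ = ΔΦ_ε + E_R` with
  `|E_R| ≤ C_E/R³` supported in `R ≤ |z| ≤ 2R` (Leibniz rule for `Δ`, the bounds on `Γ`, `∇Γ`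
  and on `∇χ_R`, `D²χ_R`), so by Young's inequality `‖K ⋆ f‖_{L²} ≤ ‖K‖_{L¹}‖f‖_{L²}` (the
  tree's `Literature.Analysis.UnboundedOperators.eLpNorm_convolution_le_lintegral_enorm_mul`, `UnboundedOperators/HeatKernel`, used
  twice) `‖ΔG‖_{L²} ≤ M_λ‖h‖_{L²} + ‖h‖_{L¹} C'R^{-3/2}`; finally
  `∂ₐ∂ₐG(x) = H^a_ε[h](x)` for `R` large (fixed `x`) and Fatou's lemma as `R → ∞`.
* §4. **The regularised pressure** `Q_ε[w](x) = -∫ D²Φ_ε(x-y)(w(y),w(y)) dy`: by bilinearity and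
  polarisation `Q_ε[w] = -½Σᵢⱼ(H^{bᵢ+bⱼ}_ε - H^{bᵢ}_ε - H^{bⱼ}_ε)[wᵢwⱼ]`, hence
  `‖Q_ε[w]‖_{L²} ≤ 27 M_λ ‖|w|²‖_{L²}`; and pointwise
  `Q_ε[w](x) = ∫_{|x-y|>ε}K(x-y)(w(y))dy - |w(x)|²/3 + O(ε)` (isotropy for the frozen
  coefficient `w(x)`, Lipschitz bound `‖D²Φ_ε‖(|w(x)|+|w(y)|)|w(y)-w(x)| ≤ 2Mε⁻³M₀M₁ε` on the ball).
* §5. **`ε → 0`.** Two integrations by parts give `H^a_ε[h] = ∫Φ_ε(· - t)∂ₐ∂ₐh(t)dt → ∫Γ(· - t)∂ₐ∂ₐh`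
  (`|Φ_ε - Γ| ≤ 1_{|z|<ε}(2π|z|)⁻¹`), so `Q_ε[w](x) → Q₀[w](x)` and the truncated singular
  integrals converge at **every** `x`: the principal value exists for `w ∈ C^∞_c`
  (`hasPressurePV_of_hasCompactSupport`, a by-product) and `p̃[w] = Q₀[w]` pointwise
  (`normalisedPressure_eq_limPressure`); measurability of `p̃[w]` as a pointwise limit, and the
  `L²` bound by Fatou along `ε = 1/(n+1)`.

## Main statements

* `eLpNorm_hessConv_le`, `eLpNorm_regPressure_le`, `abs_regPressure_sub_le`,
  `hasPressurePV_of_hasCompactSupport`, `normalisedPressure_eq_limPressure`,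
  `eLpNorm_normalisedPressure_le`.
* `stein1970_normalisedPressure_eLpNorm_le_holds` — the discharge.
* `tao_finite_energy_smooth_energy_bound_of_pv` — Tao's Lemma 8.1 from Lemma 4.1 (i) and the
  existence of principal values.

## Mathlib / tree search

`MeasureTheory.convolution`, `HasCompactSupport.hasFDerivAt_convolution_right`,
`convolution_precompR_apply`, `HasCompactSupport.contDiff_convolution_right`,
`HasCompactSupport.convolution` (used); `Measure.integral_comp_inv_smul_of_nonneg`,
`Measure.addHaar_real_closedBall`, `integral_fun_norm_addHaar` (used, via
`TaoEnergyLocalisationPressure.integral_fun_norm_eq`); `lintegral_liminf_le'`,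
`aestronglyMeasurable_of_tendsto_ae` (Fatou / measurability, used); `ContDiffAt.isSymmSndFDerivAt`
(used). No Riesz transform or Calderón–Zygmund theory in Mathlib. Tree: Young's inequality
`Literature.Analysis.UnboundedOperators.eLpNorm_convolution_le_lintegral_enorm_mul` (`UnboundedOperators/HeatKernel`, used),
`Fluid.eLpNorm_two_sq_eq_lintegral` (`LerayHopfSpatialGradient`, used);
`NS.newtonKernel`, `NS.newtonFar`, `NS.newtonFarLaplacian`, `NS.exists_bound_newtonFar_derivs`,
`NS.fderiv_fderiv_newtonKernel_apply_self` (`NewtonKernel`); `NS.newtonFar_scale`,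
`NS.norm_fderiv2_newtonFar_scale_le`, `NS.integral_abs_newtonFarLaplacian_scale`,
`NS.integrable_newtonFarLaplacian`, `NS.setIntegral_fderiv2_newtonFar_apply_self`,
`NS.measurable_newtonKernel` (`NewtonPotential`, used);
`Fluid.cutoff`, `Fluid.exists_norm_fderiv(_fderiv)_cutoff_le` (`WholeSpaceIBP`,
`SolenoidalTruncation`); `NS.pressureKernel`, `NS.truncatedPressureIntegral`, `NS.HasPressurePV`,
`NS.normalisedPressure` (`NormalisedPressure`).

## References

* E. M. Stein, *Singular integrals and differentiability properties of functions*, Princeton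
  Math. Series 30 (1970) (`Stein1971`): Ch. II §4.2 Theorem 3; Ch. III §1.3 (`∂²/∂xᵢ∂xⱼ Δ⁻¹`
  and the Riesz transforms), §1.2 (5).
* D. Gilbarg, N. S. Trudinger, *Elliptic partial differential equations of second order* (2001):
  (2.12)–(2.14), Lemma 4.2, (4.9)–(4.10), Thm 9.9 and (9.27).
* T. Tao, *Localisation and compactness properties of the Navier–Stokes global regularity
  problem*, Anal. PDE 6 (2013) = arXiv:1108.1165 (`Tao2011`): §8, proof of Lemma 8.1
  ("the singular integral `Δ⁻¹∇²` is bounded on `L²`"), (35) and (42).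
-/

noncomputable section

open MeasureTheory Set Filter Topology Function Metric InnerProductSpace
open scoped ENNReal NNReal RealInnerProductSpace ContDiff Laplacian Convolution

namespace Literature.Analysis.FluidPDE

/-- Local notation for physical space `ℝ³ = EuclideanSpace ℝ (Fin 3)`. -/
local notation "ℝ³" => EuclideanSpace ℝ (Fin 3)

/-! ## §1–§2. The regularised Newtonian kernel `Φ_ε(z) = ε⁻¹ Γ∞(ε⁻¹ z)` -/

section Scaled

-- nested operator types `ℝ³ →L[ℝ] ℝ³ →L[ℝ] ℝ` (curried second derivatives)
set_option maxSynthPendingDepth 3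

variable {ε : ℝ}

/-- **The regularised Newtonian kernel at scale `ε`**: `Φ_ε(z) = ε⁻¹ Γ∞(z/ε)`, `Γ∞` the scale-one
far kernel `newtonFar (1/2) 1` of `FluidPDE/NewtonKernel`; for `ε > 0` it is the far kernel
with radii `(ε/2, ε)` (`newtonReg_eq_newtonFar`, the scaling law `NewtonPotential.newtonFar_scale`);
written in the dilated form so that it is smooth for every `ε` with no side condition.
[folklore] -/
def newtonReg (ε : ℝ) (z : ℝ³) : ℝ := ε⁻¹ * newtonFar (1 / 2) 1 (ε⁻¹ • z)

/-- `Φ_ε` is smooth. [folklore] -/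
theorem contDiff_newtonReg (ε : ℝ) {n : ℕ∞} : ContDiff ℝ n (newtonReg ε) :=
  contDiff_const.mul ((contDiff_newtonFar (r₀ := 1 / 2) (r₁ := 1) (by norm_num) (by norm_num)).comp
    (contDiff_id.const_smul ε⁻¹))

/-- **`Φ_ε = Γ∞^{ε/2, ε}`** for `ε > 0` (the scaling law of the far kernels). [folklore] -/
theorem newtonReg_eq_newtonFar (hε : 0 < ε) : newtonReg ε = newtonFar (ε / 2) ε := by
  funext z
  have h := newtonFar_scale hε (1 / 2) 1 z
  rw [mul_one, show ε * (1 / 2) = ε / 2 by ring] at h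
  rw [newtonReg, h]

/-- `0 < ε/2 < ε` (the radii of `Φ_ε` as a far kernel). [folklore] -/
theorem half_pos_lt (hε : 0 < ε) : 0 < ε / 2 ∧ ε / 2 < ε := ⟨by positivity, by linarith⟩

/-- `Φ_ε = Γ` off the open ball of radius `ε`. [folklore] -/
theorem newtonReg_eq_newtonKernel (hε : 0 < ε) {z : ℝ³} (hz : ε ≤ ‖z‖) :
    newtonReg ε z = newtonKernel z := by
  rw [newtonReg_eq_newtonFar hε]
  exact newtonFar_eq_newtonKernel (half_pos_lt hε).1.le (half_pos_lt hε).2 hz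

/-- `Φ_ε = Γ` near every point off the closed ball of radius `ε`. [folklore] -/
theorem newtonReg_eventuallyEq_newtonKernel (hε : 0 < ε) {z : ℝ³} (hz : ε < ‖z‖) :
    newtonReg ε =ᶠ[𝓝 z] newtonKernel := by
  rw [newtonReg_eq_newtonFar hε]
  exact newtonFar_eventuallyEq_newtonKernel (half_pos_lt hε).1.le (half_pos_lt hε).2 hz

/-- `|Φ_ε(z)| ≤ (4π|z|)⁻¹` (all `z`). [folklore] -/
theorem abs_newtonReg_le (hε : 0 < ε) (z : ℝ³) : |newtonReg ε z| ≤ (4 * Real.pi * ‖z‖)⁻¹ := by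
  rw [newtonReg_eq_newtonFar hε]
  exact abs_newtonFar_le _ _ z

/-- **The Laplacian of `Φ_ε`** is the rescaled `λ`: `ΔΦ_ε = λ^{ε/2, ε}`. [folklore] -/
theorem laplacian_newtonReg (hε : 0 < ε) : Δ (newtonReg ε) = newtonFarLaplacian (ε / 2) ε := by
  rw [newtonReg_eq_newtonFar hε]
  rfl

/-- `ΔΦ_ε` vanishes off the closed ball of radius `ε`. [folklore] -/
theorem laplacian_newtonReg_eq_zero (hε : 0 < ε) {z : ℝ³} (hz : ε < ‖z‖) : Δ (newtonReg ε) z = 0 := by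
  rw [laplacian_newtonReg hε]
  exact newtonFarLaplacian_eq_zero_of_gt (half_pos_lt hε).1.le (half_pos_lt hε).2 hz

/-- `ΔΦ_ε` is continuous. [folklore] -/
theorem continuous_laplacian_newtonReg (hε : 0 < ε) : Continuous (Δ (newtonReg ε)) := by
  rw [laplacian_newtonReg hε]
  exact continuous_newtonFarLaplacian (half_pos_lt hε).1 (half_pos_lt hε).2

/-- `ΔΦ_ε` is integrable. [folklore] -/
theorem integrable_laplacian_newtonReg (hε : 0 < ε) : Integrable (Δ (newtonReg ε)) := by
  rw [laplacian_newtonReg hε]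
  exact integrable_newtonFarLaplacian (half_pos_lt hε).1 (half_pos_lt hε).2

/-- **`∫ |ΔΦ_ε| = ∫ |λ₁|`** (the `L¹` norm of the regularised Laplacian is scale invariant;
`NewtonPotential.integral_abs_newtonFarLaplacian_scale`). [folklore] -/
theorem integral_abs_laplacian_newtonReg (hε : 0 < ε) :
    ∫ z : ℝ³, |Δ (newtonReg ε) z| = ∫ w, |newtonFarLaplacian (1 / 2) 1 w| := by
  rw [laplacian_newtonReg hε]
  have h := integral_abs_newtonFarLaplacian_scale hε (1 / 2) 1
  rwa [mul_one, show ε * (1 / 2) = ε / 2 by ring] at h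

/-- **Bound for the Hessian of `Φ_ε`:** `‖D²Φ_ε(z)‖ ≤ ε⁻³ M` for all `z` and all `ε > 0`, where
`M` bounds `‖D²Γ∞‖` at scale one (`NewtonKernel.exists_bound_newtonFar_derivs`,
`NewtonPotential.norm_fderiv2_newtonFar_scale_le`). [folklore] -/
theorem exists_bound_fderiv_fderiv_newtonReg :
    ∃ M : ℝ, 0 ≤ M ∧ ∀ ε : ℝ, 0 < ε → ∀ z : ℝ³,
      ‖fderiv ℝ (fderiv ℝ (newtonReg ε)) z‖ ≤ ε⁻¹ ^ 3 * M := by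
  obtain ⟨-, -, ⟨M, hM⟩, -, -⟩ := exists_bound_newtonFar_derivs (r₀ := 1 / 2) (r₁ := 1)
    (by norm_num) (by norm_num)
  refine ⟨max M 0, le_max_right _ _, fun ε hε z => ?_⟩
  have h := norm_fderiv2_newtonFar_scale_le (r₀ := 1 / 2) (r₁ := 1) hε (M := max M 0)
    (fun w => (hM w).trans (le_max_left M 0)) z
  rw [mul_one, show ε * (1 / 2) = ε / 2 by ring] at h
  rwa [newtonReg_eq_newtonFar hε]

/-- **Isotropy at scale `ε`:** `∫_{|z| ≤ ε} ∂ₐ∂ₐΦ_ε(z) dz = |a|²/3`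
(`NewtonPotential.setIntegral_fderiv2_newtonFar_apply_self`). [folklore] -/
theorem integral_closedBall_fderiv_fderiv_newtonReg (hε : 0 < ε) (a : ℝ³) :
    ∫ z in closedBall (0 : ℝ³) ε, fderiv ℝ (fun w => fderiv ℝ (newtonReg ε) w a) z a =
      ‖a‖ ^ 2 / 3 := by
  rw [newtonReg_eq_newtonFar hε]
  have hD : Differentiable ℝ (fderiv ℝ (newtonFar (ε / 2) ε)) :=
    ((contDiff_newtonFar (half_pos_lt hε).1 (half_pos_lt hε).2 (n := 2)).fderiv_right
      (m := 1) le_rfl).differentiable one_ne_zero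
  simp_rw [FluidPDE.fderiv_apply_const_apply (hD _)]
  exact setIntegral_fderiv2_newtonFar_apply_self (half_pos_lt hε).1 (half_pos_lt hε).2 a

/-- Off the closed ball of radius `ε`, the second derivatives of `Φ_ε` are those of `Γ`:
`∂ₐ∂ₐΦ_ε(z) = -K(z)(a)`. [folklore] -/
theorem fderiv_fderiv_newtonReg_apply_eq_neg_pressureKernel (hε : 0 < ε) {z : ℝ³} (hz : ε < ‖z‖)
    (a : ℝ³) : fderiv ℝ (fun w => fderiv ℝ (newtonReg ε) w a) z a = -pressureKernel z a := by
  have hz0 : z ≠ 0 := by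
    rintro rfl
    rw [norm_zero] at hz
    linarith
  have e0 := newtonReg_eventuallyEq_newtonKernel hε hz
  have e1 : (fun w => fderiv ℝ (newtonReg ε) w a) =ᶠ[𝓝 z] fun w => fderiv ℝ newtonKernel w a := by
    filter_upwards [e0.eventually_nhds] with w hw
    have hw' : newtonReg ε =ᶠ[𝓝 w] newtonKernel := hw
    rw [hw'.fderiv_eq]
  rw [e1.fderiv_eq, fderiv_fderiv_newtonKernel_apply_self hz0]

/-- **Lipschitz dependence of the kernel on the velocity slot:** for a bilinear form `B` (such as
`D²Φ_ε(z)`), `|B(b)(b) - B(a)(a)| ≤ ‖B‖ (|a| + |b|) |b - a|`. [folklore] -/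
theorem abs_apply_apply_sub_le (B : ℝ³ →L[ℝ] ℝ³ →L[ℝ] ℝ) (a b : ℝ³) :
    |B b b - B a a| ≤ ‖B‖ * (‖a‖ + ‖b‖) * ‖b - a‖ := by
  have h : B b b - B a a = B b (b - a) + B (b - a) a := by
    rw [map_sub, map_sub, _root_.sub_apply]
    ring
  rw [h]
  calc |B b (b - a) + B (b - a) a| ≤ |B b (b - a)| + |B (b - a) a| := abs_add_le _ _
    _ ≤ ‖B‖ * ‖b‖ * ‖b - a‖ + ‖B‖ * ‖b - a‖ * ‖a‖ := by
        gcongr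
        · rw [← Real.norm_eq_abs]
          exact B.le_opNorm₂ b (b - a)
        · rw [← Real.norm_eq_abs]
          exact B.le_opNorm₂ (b - a) a
    _ = ‖B‖ * (‖a‖ + ‖b‖) * ‖b - a‖ := by ring

end Scaled

/-! ## §3a. Convolution calculus with a smooth compactly supported kernel -/

section Conv

variable {h g : ℝ³ → ℝ}

/-- The convolution with the scalar pairing, as an explicit integral. [folklore] -/
theorem convolution_lsmul_apply (h g : ℝ³ → ℝ) (x : ℝ³) :
    (h ⋆[ContinuousLinearMap.lsmul ℝ ℝ, volume] g) x = ∫ t, h t * g (x - t) := by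
  rw [convolution_lsmul]
  rfl

/-- **Directional derivative of a convolution with a smooth compactly supported kernel:**
`∂ₐ(h * g)(x) = (h * ∂ₐg)(x)`. [folklore] -/
theorem fderiv_convolution_apply (hh : LocallyIntegrable h) (hg : ContDiff ℝ 1 g)
    (hgc : HasCompactSupport g) (x a : ℝ³) :
    fderiv ℝ (h ⋆[ContinuousLinearMap.lsmul ℝ ℝ, volume] g) x a =
      (h ⋆[ContinuousLinearMap.lsmul ℝ ℝ, volume] fun s => fderiv ℝ g s a) x := by
  rw [(hgc.hasFDerivAt_convolution_right (ContinuousLinearMap.lsmul ℝ ℝ) hh hg x).fderiv,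
    convolution_precompR_apply (ContinuousLinearMap.lsmul ℝ ℝ) hh (hgc.fderiv ℝ)
      (hg.continuous_fderiv one_ne_zero)]

/-- The convolution is smooth with compact support when `h ∈ C_c` and `g ∈ C^∞_c`. [folklore] -/
theorem contDiff_convolution (hh : Continuous h) (hg : ContDiff ℝ ∞ g) (hgc : HasCompactSupport g) :
    ContDiff ℝ ∞ (h ⋆[ContinuousLinearMap.lsmul ℝ ℝ, volume] g) :=
  hgc.contDiff_convolution_right _ hh.locallyIntegrable hg

/-- The convolution of two compactly supported functions has compact support. [folklore] -/
theorem hasCompactSupport_convolution (hhc : HasCompactSupport h) (hgc : HasCompactSupport g) :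
    HasCompactSupport (h ⋆[ContinuousLinearMap.lsmul ℝ ℝ, volume] g) :=
  hhc.convolution _ hgc

/-- **Second directional derivatives:** `∂ₐ∂ₐ(h * g)(x) = ∫ h(t) ∂ₐ∂ₐg(x - t) dt`. [folklore] -/
theorem fderiv_fderiv_convolution_apply (hh : Continuous h) (hg : ContDiff ℝ ∞ g)
    (hgc : HasCompactSupport g) (x a : ℝ³) :
    fderiv ℝ (fun y => fderiv ℝ (h ⋆[ContinuousLinearMap.lsmul ℝ ℝ, volume] g) y a) x a =
      ∫ t, h t * fderiv ℝ (fun s => fderiv ℝ g s a) (x - t) a := by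
  have hg1 : ContDiff ℝ 1 g := hg.of_le (by exact_mod_cast le_top)
  have hga : ContDiff ℝ ∞ fun s => fderiv ℝ g s a :=
    (hg.fderiv_right (m := ∞) (by exact_mod_cast le_top)).clm_apply contDiff_const
  have hga1 : ContDiff ℝ 1 fun s => fderiv ℝ g s a := hga.of_le (by exact_mod_cast le_top)
  have hgac : HasCompactSupport fun s => fderiv ℝ g s a := hgc.fderiv_apply ℝ a
  have hfun : (fun y => fderiv ℝ (h ⋆[ContinuousLinearMap.lsmul ℝ ℝ, volume] g) y a) =
      (h ⋆[ContinuousLinearMap.lsmul ℝ ℝ, volume] fun s => fderiv ℝ g s a) :=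
    funext fun y => fderiv_convolution_apply hh.locallyIntegrable hg1 hgc y a
  rw [hfun, fderiv_convolution_apply hh.locallyIntegrable hga1 hgac x a, convolution_lsmul_apply]

/-- **The Laplacian of a convolution:** `Δ(h * g)(x) = ∫ h(t) Δg(x - t) dt`. [folklore] -/
theorem laplacian_convolution (hh : Continuous h) (hhc : HasCompactSupport h) (hg : ContDiff ℝ ∞ g)
    (hgc : HasCompactSupport g) (x : ℝ³) :
    Δ (h ⋆[ContinuousLinearMap.lsmul ℝ ℝ, volume] g) x = ∫ t, h t * (Δ g) (x - t) := by
  set b := stdOrthonormalBasis ℝ ℝ³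
  have h2 : ContDiff ℝ 2 (h ⋆[ContinuousLinearMap.lsmul ℝ ℝ, volume] g) :=
    contDiff_infty.1 (contDiff_convolution hh hg hgc) 2
  rw [FluidPDE.laplacian_eq_sum_fderiv_fderiv b h2 x]
  simp_rw [fderiv_fderiv_convolution_apply hh hg hgc x]
  have hint : ∀ i, Integrable fun t => h t * fderiv ℝ (fun s => fderiv ℝ g s (b i)) (x - t) (b i) := by
    intro i
    refine (hh.mul ?_).integrable_of_hasCompactSupport hhc.mul_right
    exact (FluidPDE.continuous_fderiv_fderiv_apply (contDiff_infty.1 hg 2) _ _).comp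
      (continuous_const.sub continuous_id)
  rw [← integral_finsetSum _ fun i _ => hint i]
  have hg2 : ContDiff ℝ 2 g := contDiff_infty.1 hg 2
  refine integral_congr_ae (Eventually.of_forall fun t => ?_)
  simp only
  rw [FluidPDE.laplacian_eq_sum_fderiv_fderiv b hg2 (x - t), Finset.mul_sum]

end Conv

/-! ## §3b. Truncating the regularised kernel at infinity: `Ψ = Φ_ε χ_R` and its Laplacian -/

section Truncated

-- nested operator types (curried second derivatives of the cutoff)
set_option maxSynthPendingDepth 3

variable {ε R : ℝ}

/-- The doubly regularised kernel `Ψ_{ε,R} = Φ_ε · χ_R` (`χ_R = Fluid.cutoff R`, `= 1` on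
`|z| ≤ R`, `= 0` on `|z| ≥ 2R`): smooth with compact support. [folklore] -/
def newtonRegCut (ε R : ℝ) (z : ℝ³) : ℝ := newtonReg ε z * FluidPDE.cutoff R z

/-- `Ψ_{ε,R}` is smooth. [folklore] -/
theorem contDiff_newtonRegCut (ε R : ℝ) {n : ℕ∞} : ContDiff ℝ n (newtonRegCut ε R) :=
  (contDiff_newtonReg ε).mul (FluidPDE.contDiff_cutoff R)

/-- `Ψ_{ε,R}` has compact support. [folklore] -/
theorem hasCompactSupport_newtonRegCut (ε : ℝ) (hR : 0 < R) :
    HasCompactSupport (newtonRegCut ε R) :=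
  (FluidPDE.hasCompactSupport_cutoff hR).mul_left

/-- The cutoff is locally constant off the annulus `R ≤ |z| ≤ 2R`, so its derivatives vanish
there. [folklore] -/
theorem NormalisedPressureL2Bound.cutoff_eventuallyEq_one (hR : 0 < R) {z : ℝ³} (hz : ‖z‖ < R) :
    (FluidPDE.cutoff (E := ℝ³) R) =ᶠ[𝓝 z] fun _ => 1 := by
  filter_upwards [(isOpen_lt continuous_norm continuous_const).mem_nhds hz] with w hw
  exact FluidPDE.cutoff_eq_one hR (le_of_lt hw)

/-- `χ_R = 0` near every point with `|z| > 2R`. [folklore] -/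
theorem cutoff_eventuallyEq_zero (hR : 0 < R) {z : ℝ³} (hz : 2 * R < ‖z‖) :
    (FluidPDE.cutoff (E := ℝ³) R) =ᶠ[𝓝 z] fun _ => 0 := by
  filter_upwards [(isOpen_lt continuous_const continuous_norm).mem_nhds hz] with w hw
  exact FluidPDE.cutoff_eq_zero hR (le_of_lt hw)

/-- `Dχ_R = 0` on `|z| < R`. [folklore] -/
theorem fderiv_cutoff_eq_zero_of_lt (hR : 0 < R) {z : ℝ³} (hz : ‖z‖ < R) :
    fderiv ℝ (FluidPDE.cutoff (E := ℝ³) R) z = 0 := by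
  rw [(NormalisedPressureL2Bound.cutoff_eventuallyEq_one hR hz).fderiv_eq, fderiv_fun_const, Pi.zero_apply]

/-- `Dχ_R = 0` on `|z| > 2R`. [folklore] -/
theorem fderiv_cutoff_eq_zero_of_gt (hR : 0 < R) {z : ℝ³} (hz : 2 * R < ‖z‖) :
    fderiv ℝ (FluidPDE.cutoff (E := ℝ³) R) z = 0 := by
  rw [(cutoff_eventuallyEq_zero hR hz).fderiv_eq, fderiv_fun_const, Pi.zero_apply]

/-- `Δχ_R = 0` on `|z| < R`. [folklore] -/
theorem laplacian_cutoff_eq_zero_of_lt (hR : 0 < R) {z : ℝ³} (hz : ‖z‖ < R) :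
    Δ (FluidPDE.cutoff (E := ℝ³) R) z = 0 := by
  rw [(laplacian_congr_nhds (NormalisedPressureL2Bound.cutoff_eventuallyEq_one hR hz)).eq_of_nhds,
    InnerProductSpace.laplacian_const, Pi.zero_apply]

/-- `Δχ_R = 0` on `|z| > 2R`. [folklore] -/
theorem laplacian_cutoff_eq_zero_of_gt (hR : 0 < R) {z : ℝ³} (hz : 2 * R < ‖z‖) :
    Δ (FluidPDE.cutoff (E := ℝ³) R) z = 0 := by
  rw [(laplacian_congr_nhds (cutoff_eventuallyEq_zero hR hz)).eq_of_nhds,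
    InnerProductSpace.laplacian_const, Pi.zero_apply]

/-- `|Δχ| ≤ 3 ‖D²χ‖` (trace against operator norm in dimension `3`). [folklore] -/
theorem abs_laplacian_le_three_mul_norm {χ : ℝ³ → ℝ} (hχ : ContDiff ℝ 2 χ) (z : ℝ³) :
    |Δ χ z| ≤ 3 * ‖fderiv ℝ (fderiv ℝ χ) z‖ := by
  set b := stdOrthonormalBasis ℝ ℝ³
  have hD : Differentiable ℝ (fderiv ℝ χ) :=
    (hχ.fderiv_right (m := 1) le_rfl).differentiable one_ne_zero
  rw [FluidPDE.laplacian_eq_sum_fderiv_fderiv b hχ z]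
  have hterm : ∀ i, |fderiv ℝ (fun y => fderiv ℝ χ y (b i)) z (b i)| ≤ ‖fderiv ℝ (fderiv ℝ χ) z‖ := by
    intro i
    rw [FluidPDE.fderiv_apply_const_apply (hD z), ← Real.norm_eq_abs]
    calc ‖fderiv ℝ (fderiv ℝ χ) z (b i) (b i)‖ ≤ ‖fderiv ℝ (fderiv ℝ χ) z‖ * ‖b i‖ * ‖b i‖ :=
          (fderiv ℝ (fderiv ℝ χ) z).le_opNorm₂ _ _
      _ = ‖fderiv ℝ (fderiv ℝ χ) z‖ := by rw [b.orthonormal.1, mul_one, mul_one]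
  calc |∑ i, fderiv ℝ (fun y => fderiv ℝ χ y (b i)) z (b i)|
      ≤ ∑ i, |fderiv ℝ (fun y => fderiv ℝ χ y (b i)) z (b i)| := Finset.abs_sum_le_sum_abs _ _
    _ ≤ ∑ _i : Fin (Module.finrank ℝ ℝ³), ‖fderiv ℝ (fderiv ℝ χ) z‖ := Finset.sum_le_sum fun i _ => hterm i
    _ = 3 * ‖fderiv ℝ (fderiv ℝ χ) z‖ := by
        rw [Finset.sum_const, Finset.card_univ, Fintype.card_fin, finrank_euclideanSpace_fin]
        simp

/-- The **truncation error** in the Laplacian: `E(z) = Φ_ε Δχ_R + 2 Σᵢ ∂ᵢΦ_ε ∂ᵢχ_R`. [folklore] -/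
def truncError (ε R : ℝ) (z : ℝ³) : ℝ :=
  newtonReg ε z * Δ (FluidPDE.cutoff (E := ℝ³) R) z +
    2 * ∑ i, fderiv ℝ (newtonReg ε) z (stdOrthonormalBasis ℝ ℝ³ i) *
      fderiv ℝ (FluidPDE.cutoff (E := ℝ³) R) z (stdOrthonormalBasis ℝ ℝ³ i)

/-- **`ΔΨ = ΔΦ_ε + E`** when `ε ≤ R` (`χ_R ΔΦ_ε = ΔΦ_ε`: the Laplacian of `Φ_ε` lives in
`|z| ≤ ε ≤ R`, where `χ_R = 1`). [folklore] -/
theorem laplacian_newtonRegCut (hε : 0 < ε) (hR : 0 < R) (hεR : ε ≤ R) (z : ℝ³) :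
    Δ (newtonRegCut ε R) z = Δ (newtonReg ε) z + truncError ε R z := by
  set b := stdOrthonormalBasis ℝ ℝ³
  have h := FluidPDE.laplacian_mul_eq b (contDiff_newtonReg ε (n := 2)) (FluidPDE.contDiff_cutoff (n := 2) R) z
  rw [show (fun y => newtonReg ε y * FluidPDE.cutoff R y) = newtonRegCut ε R from rfl] at h
  rw [h, truncError]
  -- `χ ΔΦ = ΔΦ`
  have hχ : FluidPDE.cutoff R z * Δ (newtonReg ε) z = Δ (newtonReg ε) z := by
    by_cases hz : ‖z‖ ≤ R
    · rw [FluidPDE.cutoff_eq_one hR hz, one_mul]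
    · rw [laplacian_newtonReg_eq_zero hε (lt_of_le_of_lt hεR (not_le.1 hz)), mul_zero]
  rw [hχ]
  ring

/-- The truncation error vanishes off the annulus `R ≤ |z| ≤ 2R`. [folklore] -/
theorem truncError_eq_zero_of_lt (hR : 0 < R) {z : ℝ³} (hz : ‖z‖ < R) : truncError ε R z = 0 := by
  rw [truncError, laplacian_cutoff_eq_zero_of_lt hR hz, fderiv_cutoff_eq_zero_of_lt hR hz]
  simp

/-- The truncation error vanishes for `|z| > 2R`. [folklore] -/
theorem truncError_eq_zero_of_gt (hR : 0 < R) {z : ℝ³} (hz : 2 * R < ‖z‖) : truncError ε R z = 0 := by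
  rw [truncError, laplacian_cutoff_eq_zero_of_gt hR hz, fderiv_cutoff_eq_zero_of_gt hR hz]
  simp

/-- The derivative of `Φ_ε` off the closed ball of radius `ε` is that of `Γ`:
`‖DΦ_ε(z)‖ = (4π|z|²)⁻¹`. [folklore] -/
theorem norm_fderiv_newtonReg (hε : 0 < ε) {z : ℝ³} (hz : ε < ‖z‖) :
    ‖fderiv ℝ (newtonReg ε) z‖ = (4 * Real.pi * ‖z‖ ^ 2)⁻¹ := by
  have hz0 : z ≠ 0 := by
    rintro rfl
    rw [norm_zero] at hz
    linarith
  rw [(newtonReg_eventuallyEq_newtonKernel hε hz).fderiv_eq, norm_fderiv_newtonKernel hz0]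

/-- The truncation error is continuous. [folklore] -/
theorem continuous_truncError (ε R : ℝ) : Continuous (truncError ε R) := by
  unfold truncError
  refine ((contDiff_newtonReg ε (n := 0)).continuous.mul
    (FluidPDE.continuous_laplacian (FluidPDE.contDiff_cutoff (n := 2) R))).add
    (continuous_const.mul (continuous_finsetSum _ fun i _ => ?_))
  exact (((contDiff_newtonReg ε (n := 1)).continuous_fderiv one_ne_zero).clm_apply
    continuous_const).mul
    (((FluidPDE.contDiff_cutoff (n := 1) R).continuous_fderiv one_ne_zero).clm_apply continuous_const)

/-- **Pointwise bound for the truncation error:** there is an absolute `C_E` with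
`|E(z)| ≤ C_E / R³` for all `z`, whenever `0 < ε < R` (on the annulus `|Φ_ε| = |Γ| ≤ (4πR)⁻¹`,
`‖DΦ_ε‖ = ‖DΓ‖ ≤ (4πR²)⁻¹`, `|Δχ_R| ≤ 3C₂/R²`, `‖Dχ_R‖ ≤ C₁/R`). [folklore] -/
theorem exists_bound_truncError :
    ∃ C_E : ℝ, 0 ≤ C_E ∧ ∀ ε R : ℝ, 0 < ε → ε < R → ∀ z : ℝ³, |truncError ε R z| ≤ C_E / R ^ 3 := by
  obtain ⟨C₁, hC₁0, hC₁⟩ := FluidPDE.exists_norm_fderiv_cutoff_le (E := ℝ³)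
  obtain ⟨C₂, hC₂0, hC₂⟩ := FluidPDE.exists_norm_fderiv_fderiv_cutoff_le (E := ℝ³)
  refine ⟨(3 * C₂ + 2 * C₁) / (4 * Real.pi), by positivity, fun ε R hε hεR z => ?_⟩
  have hR : 0 < R := hε.trans hεR
  set b := stdOrthonormalBasis ℝ ℝ³
  by_cases hz1 : ‖z‖ < R
  · rw [truncError_eq_zero_of_lt hR hz1, abs_zero]; positivity
  by_cases hz2 : 2 * R < ‖z‖
  · rw [truncError_eq_zero_of_gt hR hz2, abs_zero]; positivity
  rw [not_lt] at hz1 hz2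
  have hzε : ε < ‖z‖ := lt_of_lt_of_le hεR hz1
  have hz0 : 0 < ‖z‖ := hR.trans_le hz1
  -- the four size bounds
  have i1 : |newtonReg ε z| ≤ (4 * Real.pi * R)⁻¹ := by
    refine (abs_newtonReg_le hε z).trans ?_
    rw [inv_le_inv₀ (by positivity) (by positivity)]
    gcongr
  have i2 : |Δ (FluidPDE.cutoff (E := ℝ³) R) z| ≤ 3 * (C₂ / R ^ 2) :=
    (abs_laplacian_le_three_mul_norm (FluidPDE.contDiff_cutoff (n := 2) R) z).trans
      (by gcongr; exact hC₂ R hR z)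
  have i3 : ‖fderiv ℝ (newtonReg ε) z‖ ≤ (4 * Real.pi * R ^ 2)⁻¹ := by
    rw [norm_fderiv_newtonReg hε hzε, inv_le_inv₀ (by positivity) (by positivity)]
    gcongr
  have i4 : ‖fderiv ℝ (FluidPDE.cutoff (E := ℝ³) R) z‖ ≤ C₁ / R := hC₁ R hR z
  have i5 : |∑ i, fderiv ℝ (newtonReg ε) z (b i) * fderiv ℝ (FluidPDE.cutoff (E := ℝ³) R) z (b i)| ≤
      (4 * Real.pi * R ^ 2)⁻¹ * (C₁ / R) :=
    (FluidPDE.abs_sum_fderiv_mul_fderiv_le b _ _ z).trans (mul_le_mul i3 i4 (norm_nonneg _)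
      (by positivity))
  rw [truncError]
  calc |newtonReg ε z * Δ (FluidPDE.cutoff (E := ℝ³) R) z +
        2 * ∑ i, fderiv ℝ (newtonReg ε) z (b i) * fderiv ℝ (FluidPDE.cutoff (E := ℝ³) R) z (b i)|
      ≤ |newtonReg ε z| * |Δ (FluidPDE.cutoff (E := ℝ³) R) z| +
          2 * |∑ i, fderiv ℝ (newtonReg ε) z (b i) * fderiv ℝ (FluidPDE.cutoff (E := ℝ³) R) z (b i)| := by
        refine (abs_add_le _ _).trans ?_
        rw [abs_mul, abs_mul, abs_two]
    _ ≤ (4 * Real.pi * R)⁻¹ * (3 * (C₂ / R ^ 2)) + 2 * ((4 * Real.pi * R ^ 2)⁻¹ * (C₁ / R)) := by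
        gcongr
    _ = (3 * C₂ + 2 * C₁) / (4 * Real.pi) / R ^ 3 := by
        field_simp

/-- The truncation error is square integrable with `∫ E² ≤ (C_E/R³)² · vol(B̄(0,2R))`, hence
`‖E‖_{L²} ≤ C_E' R^{-3/2}`; we record the `ℝ≥0∞` form used below:
`eLpNorm E 2 ≤ ofReal (C_E √(32π/3) · R^{-3/2})`, stated with `√R³` to avoid real powers.
[folklore] -/
theorem eLpNorm_truncError_le {C_E : ℝ} (hC0 : 0 ≤ C_E)
    (hC : ∀ ε R : ℝ, 0 < ε → ε < R → ∀ z : ℝ³, |truncError ε R z| ≤ C_E / R ^ 3)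
    (hε : 0 < ε) (hεR : ε < R) :
    eLpNorm (truncError ε R) 2 volume ≤
      ENNReal.ofReal (C_E * Real.sqrt (32 * Real.pi / 3) / Real.sqrt (R ^ 3)) := by
  have hR : 0 < R := hε.trans hεR
  set S : Set ℝ³ := closedBall (0 : ℝ³) (2 * R) with hS
  have hSm : MeasurableSet S := measurableSet_closedBall
  -- pointwise: `E² ≤ (C_E/R³)² 1_S`
  have hpt : ∀ z, ‖truncError ε R z‖ ^ 2 ≤ S.indicator (fun _ => (C_E / R ^ 3) ^ 2) z := by
    intro z
    by_cases hz : z ∈ S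
    · rw [indicator_of_mem hz, Real.norm_eq_abs]
      exact pow_le_pow_left₀ (abs_nonneg _) (hC ε R hε hεR z) 2
    · rw [indicator_of_notMem hz]
      rw [hS, mem_closedBall_zero_iff, not_le] at hz
      rw [truncError_eq_zero_of_gt hR hz, norm_zero, zero_pow two_ne_zero]
  have hvol : (volume : Measure ℝ³).real S = (2 * R) ^ 3 * (4 * Real.pi / 3) := by
    rw [hS, Measure.addHaar_real_closedBall volume (0 : ℝ³) (by positivity),
      finrank_euclideanSpace_fin, volume_real_ball_zero_one]
  have hint : Integrable (S.indicator fun _ : ℝ³ => (C_E / R ^ 3) ^ 2) :=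
    (integrable_indicator_iff hSm).2 (integrableOn_const (hs := by
      rw [hS]; exact (isCompact_closedBall _ _).measure_lt_top.ne))
  have hI : ∫ z, ‖truncError ε R z‖ ^ 2 ≤ (C_E * Real.sqrt (32 * Real.pi / 3) / Real.sqrt (R ^ 3)) ^ 2 := by
    calc ∫ z, ‖truncError ε R z‖ ^ 2 ≤ ∫ z, S.indicator (fun _ => (C_E / R ^ 3) ^ 2) z := by
          refine integral_mono_of_nonneg (Eventually.of_forall fun z => by positivity) hint
            (Eventually.of_forall hpt)
      _ = (C_E / R ^ 3) ^ 2 * ((2 * R) ^ 3 * (4 * Real.pi / 3)) := by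
          rw [integral_indicator hSm, setIntegral_const, smul_eq_mul, hvol, mul_comm]
      _ = (C_E * Real.sqrt (32 * Real.pi / 3) / Real.sqrt (R ^ 3)) ^ 2 := by
          have e : (C_E * Real.sqrt (32 * Real.pi / 3) / Real.sqrt (R ^ 3)) ^ 2 =
              C_E ^ 2 * (32 * Real.pi / 3) / R ^ 3 := by
            rw [div_pow, mul_pow, Real.sq_sqrt (by positivity), Real.sq_sqrt (by positivity)]
          rw [e]
          field_simp
          ring
  have hmem : MemLp (truncError ε R) 2 volume :=
    (continuous_truncError ε R).memLp_of_hasCompactSupport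
      (HasCompactSupport.intro (isCompact_closedBall (0 : ℝ³) (2 * R)) fun z hz => by
        rw [mem_closedBall_zero_iff, not_le] at hz
        exact truncError_eq_zero_of_gt hR hz)
  have h := eLpNorm_two_le_ofReal_sqrt hmem hI
  rwa [Real.sqrt_sq (by positivity)] at h

end Truncated

/-! ## §3c. The `L²` bound for the regularised Hessian convolutions `∫ h(t) ∂ₐ∂ₐΦ_ε(x - t) dt` -/

section HessianL2

variable {ε R : ℝ} {h : ℝ³ → ℝ}

/-- The `L¹` mass of the regularised Laplacian, `M_λ = ∫ |λ₁|` (scale invariant). [folklore] -/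
def regLaplacianMass : ℝ := ∫ w : ℝ³, |newtonFarLaplacian (1 / 2) 1 w|

/-- `0 ≤ M_λ`. [folklore] -/
theorem regLaplacianMass_nonneg : 0 ≤ regLaplacianMass := integral_nonneg fun _ => abs_nonneg _

/-- `∫⁻ ‖ΔΦ_ε‖ₑ = ofReal M_λ`. [folklore] -/
theorem lintegral_enorm_laplacian_newtonReg (hε : 0 < ε) :
    ∫⁻ z, ‖Δ (newtonReg ε) z‖ₑ = ENNReal.ofReal regLaplacianMass := by
  rw [← ofReal_integral_norm_eq_lintegral_enorm (integrable_laplacian_newtonReg hε), regLaplacianMass,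
    ← integral_abs_laplacian_newtonReg hε]
  rfl

/-- Measurability of `x ↦ ∫ h(t) k(x - t) dt` for continuous `h`, `k`. [folklore] -/
theorem aestronglyMeasurable_conv {k : ℝ³ → ℝ} (hh : Continuous h) (hk : Continuous k) :
    AEStronglyMeasurable (fun x => ∫ t, h t * k (x - t)) volume := by
  have hm : StronglyMeasurable (uncurry fun x t : ℝ³ => h t * k (x - t)) :=
    ((hh.comp continuous_snd).mul (hk.comp (continuous_fst.sub continuous_snd))).stronglyMeasurable
  exact hm.integral_prod_right.aestronglyMeasurable

/-- `‖f‖_{L²} = ofReal √(∫ f²)` for `f ∈ L²` real-valued. [folklore] -/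
theorem eLpNorm_two_eq_ofReal_sqrt {f : ℝ³ → ℝ} (hf : MemLp f 2 volume) :
    eLpNorm f 2 volume = ENNReal.ofReal (Real.sqrt (∫ x, f x ^ 2)) := by
  have h := eLpNorm_natCast_eq_ofReal (n := 2) two_ne_zero (by exact_mod_cast hf)
  rw [Nat.cast_ofNat] at h
  rw [h, Real.sqrt_eq_rpow]
  simp only [Real.norm_eq_abs, sq_abs, Nat.cast_ofNat, one_div]

/-- From `∫ f² ≤ c² ∫ g²` (`f, g ∈ L²`, `c ≥ 0`) to `‖f‖_{L²} ≤ c ‖g‖_{L²}`. [folklore] -/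
theorem eLpNorm_le_of_integral_sq_le {f g : ℝ³ → ℝ} (hf : MemLp f 2 volume) (hg : MemLp g 2 volume)
    {c : ℝ} (hc : 0 ≤ c) (h : ∫ x, f x ^ 2 ≤ c ^ 2 * ∫ x, g x ^ 2) :
    eLpNorm f 2 volume ≤ ENNReal.ofReal c * eLpNorm g 2 volume := by
  rw [eLpNorm_two_eq_ofReal_sqrt hf, eLpNorm_two_eq_ofReal_sqrt hg, ← ENNReal.ofReal_mul hc]
  refine ENNReal.ofReal_le_ofReal ?_
  rw [← Real.sqrt_sq hc, ← Real.sqrt_mul (sq_nonneg c)]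
  exact Real.sqrt_le_sqrt h

/-- **`L²` bound for the truncated Hessian convolution.** For `h ∈ C_c`, `0 < ε < R` and
`G = h * Ψ_{ε,R}`:
`‖∂ₐ∂ₐG‖_{L²} ≤ |a|² (M_λ ‖h‖_{L²} + ‖h‖_{L¹} · C_E' /√(R³))`. [folklore] -/
theorem eLpNorm_fderiv_fderiv_conv_newtonRegCut_le {C_E : ℝ} (hC0 : 0 ≤ C_E)
    (hC : ∀ ε R : ℝ, 0 < ε → ε < R → ∀ z : ℝ³, |truncError ε R z| ≤ C_E / R ^ 3)
    (hε : 0 < ε) (hεR : ε < R) (hh : Continuous h) (hhc : HasCompactSupport h) (a : ℝ³) :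
    eLpNorm (fun x => fderiv ℝ (fun y => fderiv ℝ
        (h ⋆[ContinuousLinearMap.lsmul ℝ ℝ, volume] newtonRegCut ε R) y a) x a) 2 volume ≤
      ENNReal.ofReal (‖a‖ ^ 2) *
        (ENNReal.ofReal regLaplacianMass * eLpNorm h 2 volume +
          (∫⁻ t, ‖h t‖ₑ) * ENNReal.ofReal (C_E * Real.sqrt (32 * Real.pi / 3) / Real.sqrt (R ^ 3))) := by
  have hR : 0 < R := hε.trans hεR
  set Ψ := newtonRegCut ε R with hΨ
  have hΨs : ContDiff ℝ ∞ Ψ := contDiff_newtonRegCut ε R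
  have hΨc : HasCompactSupport Ψ := hasCompactSupport_newtonRegCut ε hR
  set G := h ⋆[ContinuousLinearMap.lsmul ℝ ℝ, volume] Ψ with hG
  have hGs : ContDiff ℝ ∞ G := contDiff_convolution hh hΨs hΨc
  have hG3 : ContDiff ℝ 3 G := contDiff_infty.1 hGs 3
  have hG2 : ContDiff ℝ 2 G := contDiff_infty.1 hGs 2
  have hGc : HasCompactSupport G := hasCompactSupport_convolution hhc hΨc
  -- step 1: Hessian ≤ Laplacian in `L²`
  have hDD : MemLp (fun x => fderiv ℝ (fun y => fderiv ℝ G y a) x a) 2 volume :=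
    (FluidPDE.continuous_fderiv_fderiv_apply hG2 a a).memLp_of_hasCompactSupport
      (FluidPDE.hasCompactSupport_fderiv_fderiv_apply hGc a a)
  have hΔc : Continuous (Δ G) := FluidPDE.continuous_laplacian hG2
  have hΔs : HasCompactSupport (Δ G) :=
    hGc.mono' fun x hx => by
      contrapose! hx
      simp only [mem_support, not_not]
      exact FluidPDE.laplacian_eq_zero_of_notMem_tsupport hx
  have hΔ : MemLp (Δ G) 2 volume := hΔc.memLp_of_hasCompactSupport hΔs
  have step1 : eLpNorm (fun x => fderiv ℝ (fun y => fderiv ℝ G y a) x a) 2 volume ≤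
      ENNReal.ofReal (‖a‖ ^ 2) * eLpNorm (Δ G) 2 volume := by
    refine eLpNorm_le_of_integral_sq_le hDD hΔ (sq_nonneg _) ?_
    rw [← pow_mul]
    exact FluidPDE.integral_sq_fderiv_fderiv_apply_le hG3 hGc a
  -- step 2: `ΔG = h * ΔΦ_ε + h * E`
  have hΔeq : (Δ G) = fun x => (∫ t, h t * Δ (newtonReg ε) (x - t)) + ∫ t, h t * truncError ε R (x - t) := by
    funext x
    rw [hG, laplacian_convolution hh hhc hΨs hΨc x]
    have e : ∀ t, h t * Δ Ψ (x - t) = h t * Δ (newtonReg ε) (x - t) + h t * truncError ε R (x - t) := by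
      intro t
      rw [hΨ, laplacian_newtonRegCut hε hR hεR.le]
      ring
    simp_rw [e]
    refine integral_add ?_ ?_
    · exact (hh.mul ((continuous_laplacian_newtonReg hε).comp (continuous_const.sub continuous_id)))
        |>.integrable_of_hasCompactSupport hhc.mul_right
    · exact (hh.mul ((continuous_truncError ε R).comp (continuous_const.sub continuous_id)))
        |>.integrable_of_hasCompactSupport hhc.mul_right
  have step2 : eLpNorm (Δ G) 2 volume ≤
      eLpNorm (fun x => ∫ t, h t * Δ (newtonReg ε) (x - t)) 2 volume +
        eLpNorm (fun x => ∫ t, h t * truncError ε R (x - t)) 2 volume := by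
    rw [hΔeq]
    exact eLpNorm_add_le (aestronglyMeasurable_conv hh (continuous_laplacian_newtonReg hε))
      (aestronglyMeasurable_conv hh (continuous_truncError ε R)) one_le_two
  -- step 3: Young's inequality `‖K ⋆ f‖₂ ≤ ‖K‖₁ ‖f‖₂` (tree, `UnboundedOperators/HeatKernel`)
  have y1 : eLpNorm (fun x => ∫ t, h t * Δ (newtonReg ε) (x - t)) 2 volume ≤
      ENNReal.ofReal regLaplacianMass * eLpNorm h 2 volume := by
    -- `∫ h(t) ΔΦ(x-t) dt = (ΔΦ ⋆ h)(x)` (flip the convolution)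
    have hflip : (fun x => ∫ t, h t * Δ (newtonReg ε) (x - t)) =
        (Δ (newtonReg ε) ⋆[ContinuousLinearMap.lsmul ℝ ℝ, volume] h) := by
      funext x
      rw [convolution_lsmul_apply]
      have := integral_sub_left_eq_self (fun t => Δ (newtonReg ε) t * h (x - t)) volume x
      simp only [sub_sub_cancel] at this
      rw [← this]
      exact integral_congr_ae (Eventually.of_forall fun t => mul_comm _ _)
    rw [hflip, ← lintegral_enorm_laplacian_newtonReg hε]
    exact UnboundedOperators.eLpNorm_convolution_le_lintegral_enorm_mul
      (continuous_laplacian_newtonReg hε).aestronglyMeasurable hh.aestronglyMeasurable one_le_two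
  have y2 : eLpNorm (fun x => ∫ t, h t * truncError ε R (x - t)) 2 volume ≤
      (∫⁻ t, ‖h t‖ₑ) * ENNReal.ofReal (C_E * Real.sqrt (32 * Real.pi / 3) / Real.sqrt (R ^ 3)) := by
    have hconv : (fun x => ∫ t, h t * truncError ε R (x - t)) =
        (h ⋆[ContinuousLinearMap.lsmul ℝ ℝ, volume] truncError ε R) :=
      funext fun x => (convolution_lsmul_apply h (truncError ε R) x).symm
    rw [hconv]
    exact (UnboundedOperators.eLpNorm_convolution_le_lintegral_enorm_mul hh.aestronglyMeasurable
      (continuous_truncError ε R).aestronglyMeasurable one_le_two).trans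
      (mul_le_mul' le_rfl (eLpNorm_truncError_le hC0 hC hε hεR))
  calc eLpNorm (fun x => fderiv ℝ (fun y => fderiv ℝ G y a) x a) 2 volume
      ≤ ENNReal.ofReal (‖a‖ ^ 2) * eLpNorm (Δ G) 2 volume := step1
    _ ≤ ENNReal.ofReal (‖a‖ ^ 2) *
        (eLpNorm (fun x => ∫ t, h t * Δ (newtonReg ε) (x - t)) 2 volume +
          eLpNorm (fun x => ∫ t, h t * truncError ε R (x - t)) 2 volume) := by gcongr
    _ ≤ _ := by gcongr

/-- **The regularised Hessian convolution** `H^a_ε[h](x) = ∫ h(t) ∂ₐ∂ₐΦ_ε(x - t) dt`. [folklore] -/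
def hessConv (ε : ℝ) (h : ℝ³ → ℝ) (a x : ℝ³) : ℝ :=
  ∫ t, h t * fderiv ℝ (fun s => fderiv ℝ (newtonReg ε) s a) (x - t) a

/-- `H^a_ε[h]` is measurable. [folklore] -/
theorem aestronglyMeasurable_hessConv (ε : ℝ) (hh : Continuous h) (a : ℝ³) :
    AEStronglyMeasurable (hessConv ε h a) volume :=
  aestronglyMeasurable_conv hh (FluidPDE.continuous_fderiv_fderiv_apply (contDiff_newtonReg ε (n := 2)) a a)

/-- Local agreement of second directional derivatives. [folklore] -/
theorem fderiv_fderiv_apply_congr_of_eventuallyEq {f g : ℝ³ → ℝ} {p : ℝ³} (hfg : f =ᶠ[𝓝 p] g)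
    (a : ℝ³) :
    fderiv ℝ (fun s => fderiv ℝ f s a) p a = fderiv ℝ (fun s => fderiv ℝ g s a) p a := by
  have h1 : (fun s => fderiv ℝ f s a) =ᶠ[𝓝 p] fun s => fderiv ℝ g s a := by
    filter_upwards [hfg.eventually_nhds] with w hw
    have hw' : f =ᶠ[𝓝 w] g := hw
    rw [hw'.fderiv_eq]
  rw [h1.fderiv_eq]

/-- **Eventual equality:** for every `x`, once `R ≥ ‖x‖ + R_h + 1` (`supp h ⊂ B̄(0, R_h)`),
`∂ₐ∂ₐ(h * Ψ_{ε,R})(x) = H^a_ε[h](x)` (the cutoff is `1` near every `x - t`, `t ∈ supp h`).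
[folklore] -/
theorem fderiv_fderiv_conv_newtonRegCut_eq_hessConv (hh : Continuous h) {R_h : ℝ}
    (hRh : tsupport h ⊆ closedBall (0 : ℝ³) R_h) {x : ℝ³} (hR : ‖x‖ + R_h + 1 ≤ R) (hR0 : 0 < R)
    (a : ℝ³) :
    fderiv ℝ (fun y => fderiv ℝ (h ⋆[ContinuousLinearMap.lsmul ℝ ℝ, volume] newtonRegCut ε R) y a) x a =
      hessConv ε h a x := by
  rw [fderiv_fderiv_convolution_apply hh (contDiff_newtonRegCut ε R)
    (hasCompactSupport_newtonRegCut ε hR0) x a, hessConv]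
  refine integral_congr_ae (Eventually.of_forall fun t => ?_)
  simp only
  by_cases ht : t ∈ tsupport h
  · have htn : ‖t‖ ≤ R_h := mem_closedBall_zero_iff.1 (hRh ht)
    have hxt : ‖x - t‖ < R := by
      calc ‖x - t‖ ≤ ‖x‖ + ‖t‖ := norm_sub_le _ _
        _ ≤ ‖x‖ + R_h := by linarith
        _ < R := by linarith
    have hloc : newtonRegCut ε R =ᶠ[𝓝 (x - t)] newtonReg ε := by
      filter_upwards [NormalisedPressureL2Bound.cutoff_eventuallyEq_one hR0 hxt] with w hw
      rw [newtonRegCut, hw, mul_one]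
    rw [fderiv_fderiv_apply_congr_of_eventuallyEq hloc a]
  · rw [image_eq_zero_of_notMem_tsupport ht, zero_mul, zero_mul]

/-- **`L²` bound for the regularised Hessian convolution** (`h ∈ C_c`):
`‖H^a_ε[h]‖_{L²} ≤ |a|² M_λ ‖h‖_{L²}` (truncate at `R = ε + n + 1`, Fatou as `n → ∞`).
[folklore] -/
theorem eLpNorm_hessConv_le (hε : 0 < ε) (hh : Continuous h) (hhc : HasCompactSupport h) (a : ℝ³) :
    eLpNorm (hessConv ε h a) 2 volume ≤
      ENNReal.ofReal (‖a‖ ^ 2) * (ENNReal.ofReal regLaplacianMass * eLpNorm h 2 volume) := by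
  obtain ⟨C_E, hC0, hC⟩ := exists_bound_truncError
  obtain ⟨R_h, hRh⟩ : ∃ R_h : ℝ, tsupport h ⊆ closedBall (0 : ℝ³) R_h :=
    (hhc.isCompact.isBounded).subset_closedBall 0
  -- the truncations `R_n = ε + n + 1`
  set Rn : ℕ → ℝ := fun n => ε + n + 1 with hRn
  have hRnε : ∀ n, ε < Rn n := fun n => by
    simp only [hRn]
    have : (0 : ℝ) ≤ n := n.cast_nonneg
    linarith
  have hRn0 : ∀ n, 0 < Rn n := fun n => hε.trans (hRnε n)
  set F : ℕ → ℝ³ → ℝ := fun n x => fderiv ℝ (fun y => fderiv ℝ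
    (h ⋆[ContinuousLinearMap.lsmul ℝ ℝ, volume] newtonRegCut ε (Rn n)) y a) x a with hF
  -- eventual equality and the liminf of the integrands
  have hev : ∀ x, ∀ᶠ n in atTop, F n x = hessConv ε h a x := by
    intro x
    obtain ⟨N, hN⟩ := exists_nat_ge (‖x‖ + R_h)
    filter_upwards [Filter.eventually_ge_atTop N] with n hn
    refine fderiv_fderiv_conv_newtonRegCut_eq_hessConv hh hRh ?_ (hRn0 n) a
    simp only [hRn]
    have : (N : ℝ) ≤ n := by exact_mod_cast hn
    linarith [hε.le]
  have hlim : ∀ x, liminf (fun n => ‖F n x‖ₑ ^ 2) atTop = ‖hessConv ε h a x‖ₑ ^ 2 := by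
    intro x
    refine Tendsto.liminf_eq ?_
    refine (tendsto_const_nhds (x := ‖hessConv ε h a x‖ₑ ^ 2)).congr' ?_
    filter_upwards [hev x] with n hn
    rw [hn]
  -- measurability of the truncated Hessians
  have hFm : ∀ n, AEMeasurable (fun x => ‖F n x‖ₑ ^ 2) volume := by
    intro n
    have hG2 : ContDiff ℝ 2 (h ⋆[ContinuousLinearMap.lsmul ℝ ℝ, volume] newtonRegCut ε (Rn n)) :=
      contDiff_infty.1 (contDiff_convolution hh (contDiff_newtonRegCut ε (Rn n))
        (hasCompactSupport_newtonRegCut ε (hRn0 n))) 2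
    exact ((FluidPDE.continuous_fderiv_fderiv_apply hG2 a a).measurable.enorm.pow_const 2).aemeasurable
  -- Fatou
  have hFatou : ∫⁻ x, ‖hessConv ε h a x‖ₑ ^ 2 ≤ liminf (fun n => ∫⁻ x, ‖F n x‖ₑ ^ 2) atTop := by
    calc ∫⁻ x, ‖hessConv ε h a x‖ₑ ^ 2 = ∫⁻ x, liminf (fun n => ‖F n x‖ₑ ^ 2) atTop :=
          lintegral_congr fun x => (hlim x).symm
      _ ≤ liminf (fun n => ∫⁻ x, ‖F n x‖ₑ ^ 2) atTop := lintegral_liminf_le' hFm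
  -- the bounds `b_n` and their limit
  set A : ℝ≥0∞ := ENNReal.ofReal (‖a‖ ^ 2) with hA
  set B : ℝ≥0∞ := ENNReal.ofReal regLaplacianMass * eLpNorm h 2 volume with hB
  set Ch : ℝ≥0∞ := ∫⁻ t, ‖h t‖ₑ with hCh
  have hCh_top : Ch ≠ ⊤ := (hh.integrable_of_hasCompactSupport hhc).2.ne
  set c : ℕ → ℝ := fun n => C_E * Real.sqrt (32 * Real.pi / 3) / Real.sqrt (Rn n ^ 3) with hc
  have hbn : ∀ n, ∫⁻ x, ‖F n x‖ₑ ^ 2 ≤ (A * (B + Ch * ENNReal.ofReal (c n))) ^ 2 := by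
    intro n
    have h1 := eLpNorm_fderiv_fderiv_conv_newtonRegCut_le hC0 hC hε (hRnε n) hh hhc a
    rw [← FluidPDE.eLpNorm_two_sq_eq_lintegral]
    exact pow_le_pow_left' h1 2
  -- `c n → 0`
  have hc0 : Tendsto c atTop (𝓝 0) := by
    have h1 : Tendsto (fun n => Real.sqrt (Rn n ^ 3)) atTop atTop := by
      refine Real.tendsto_sqrt_atTop.comp ?_
      refine (tendsto_pow_atTop three_ne_zero).comp ?_
      simp only [hRn]
      refine tendsto_atTop_add_const_right _ 1 (tendsto_atTop_add_const_left _ ε ?_)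
      exact tendsto_natCast_atTop_atTop
    simp only [hc]
    exact Tendsto.div_atTop tendsto_const_nhds h1
  have hlimb : Tendsto (fun n => (A * (B + Ch * ENNReal.ofReal (c n))) ^ 2) atTop (𝓝 ((A * B) ^ 2)) := by
    have t1 : Tendsto (fun n => ENNReal.ofReal (c n)) atTop (𝓝 0) := by
      rw [← ENNReal.ofReal_zero]
      exact ENNReal.tendsto_ofReal hc0
    have t2 : Tendsto (fun n => Ch * ENNReal.ofReal (c n)) atTop (𝓝 0) := by
      rw [← mul_zero Ch]
      exact ENNReal.Tendsto.const_mul t1 (Or.inr hCh_top)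
    have t3 : Tendsto (fun n => B + Ch * ENNReal.ofReal (c n)) atTop (𝓝 (B + 0)) :=
      tendsto_const_nhds.add t2
    rw [add_zero] at t3
    have t4 : Tendsto (fun n => A * (B + Ch * ENNReal.ofReal (c n))) atTop (𝓝 (A * B)) :=
      ENNReal.Tendsto.const_mul t3 (Or.inr ENNReal.ofReal_ne_top)
    exact ((ENNReal.continuous_pow 2).tendsto (A * B)).comp t4
  have hkey : ∫⁻ x, ‖hessConv ε h a x‖ₑ ^ 2 ≤ (A * B) ^ 2 := by
    refine hFatou.trans ?_
    rw [← hlimb.liminf_eq]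
    exact liminf_le_liminf (Eventually.of_forall hbn)
  rw [← FluidPDE.eLpNorm_two_sq_eq_lintegral] at hkey
  exact (ENNReal.pow_right_strictMono two_ne_zero).le_iff_le.1 hkey

end HessianL2

/-! ## §4. The regularised pressure `Q_ε[w](x) = -∫ D²Φ_ε(x-y)(w(y), w(y)) dy` -/

section RegPressure

-- nested operator types (curried second derivatives)
set_option maxSynthPendingDepth 3

variable {ε : ℝ} {w : ℝ³ → ℝ³}

/-- The curried Hessian of `Φ_ε`, `D²Φ_ε(z) ∈ L(ℝ³, L(ℝ³, ℝ))`. [folklore] -/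
abbrev hessReg (ε : ℝ) (z : ℝ³) : ℝ³ →L[ℝ] ℝ³ →L[ℝ] ℝ := fderiv ℝ (fderiv ℝ (newtonReg ε)) z

/-- `D²Φ_ε` is continuous. [folklore] -/
theorem continuous_hessReg (ε : ℝ) : Continuous (hessReg ε) :=
  ((contDiff_newtonReg ε (n := 2)).fderiv_right (m := 1) le_rfl).continuous_fderiv one_ne_zero

/-- Directional form: `∂_c∂ₐΦ_ε(z) = D²Φ_ε(z)(c)(a)`. [folklore] -/
theorem fderiv_fderiv_newtonReg_apply_eq_hessReg (ε : ℝ) (z a c : ℝ³) :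
    fderiv ℝ (fun s => fderiv ℝ (newtonReg ε) s a) z c = hessReg ε z c a :=
  FluidPDE.fderiv_apply_const_apply
    ((((contDiff_newtonReg ε (n := 2)).fderiv_right (m := 1) le_rfl).differentiable one_ne_zero) z) a c

/-- **Symmetry of `D²Φ_ε`.** [folklore] -/
theorem hessReg_symm (ε : ℝ) (z a c : ℝ³) : hessReg ε z a c = hessReg ε z c a := by
  have h22 : minSmoothness ℝ 2 ≤ (2 : ℕ∞ω) := by
    rw [minSmoothness_of_isRCLikeNormedField]
  exact ((contDiff_newtonReg ε (n := 2)).contDiffAt.isSymmSndFDerivAt h22).eq a c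

/-- **Polarisation:** `D²Φ_ε(z)(bᵢ)(bⱼ) = ½ (∂_{bᵢ+bⱼ}²Φ_ε - ∂ᵢ²Φ_ε - ∂ⱼ²Φ_ε)(z)`. [folklore] -/
theorem hessReg_polarisation (ε : ℝ) (z u v : ℝ³) :
    hessReg ε z u v = 2⁻¹ * (hessReg ε z (u + v) (u + v) - hessReg ε z u u - hessReg ε z v v) := by
  have hs := hessReg_symm ε z v u
  simp only [map_add, _root_.add_apply]
  linarith

/-- The coordinate functions of `w` in the basis `b`: `wᵢ = ⟨w, bᵢ⟩`. [folklore] -/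
def coord (w : ℝ³ → ℝ³) (i : Fin (Module.finrank ℝ ℝ³)) (y : ℝ³) : ℝ := ⟪w y, stdOrthonormalBasis ℝ ℝ³ i⟫

/-- The coordinate functions are smooth. [folklore] -/
theorem contDiff_coord (hw : ContDiff ℝ ∞ w) (i : Fin (Module.finrank ℝ ℝ³)) : ContDiff ℝ ∞ (coord w i) :=
  hw.inner ℝ contDiff_const

/-- The coordinate functions have compact support. [folklore] -/
theorem hasCompactSupport_coord (hwc : HasCompactSupport w) (i : Fin (Module.finrank ℝ ℝ³)) :
    HasCompactSupport (coord w i) :=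
  hwc.mono fun y hy => by
    rw [mem_support] at hy ⊢
    contrapose! hy
    rw [coord, hy, inner_zero_left]

/-- The products `wᵢwⱼ`. [folklore] -/
def coordProd (w : ℝ³ → ℝ³) (i j : Fin (Module.finrank ℝ ℝ³)) (y : ℝ³) : ℝ := coord w i y * coord w j y

/-- The products `wᵢwⱼ` are smooth. [folklore] -/
theorem contDiff_coordProd (hw : ContDiff ℝ ∞ w) (i j : Fin (Module.finrank ℝ ℝ³)) :
    ContDiff ℝ ∞ (coordProd w i j) :=
  (contDiff_coord hw i).mul (contDiff_coord hw j)

/-- The products `wᵢwⱼ` are continuous. [folklore] -/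
theorem continuous_coordProd (hw : Continuous w) (i j : Fin (Module.finrank ℝ ℝ³)) :
    Continuous (coordProd w i j) :=
  (hw.inner continuous_const).mul (hw.inner continuous_const)

/-- The products `wᵢwⱼ` have compact support. [folklore] -/
theorem hasCompactSupport_coordProd (hwc : HasCompactSupport w) (i j : Fin (Module.finrank ℝ ℝ³)) :
    HasCompactSupport (coordProd w i j) :=
  (hasCompactSupport_coord hwc j).mul_left

/-- `|wᵢwⱼ| ≤ |w|²`. [folklore] -/
theorem abs_coordProd_le (w : ℝ³ → ℝ³) (i j : Fin (Module.finrank ℝ ℝ³)) (y : ℝ³) :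
    |coordProd w i j y| ≤ ‖w y‖ ^ 2 := by
  set b := stdOrthonormalBasis ℝ ℝ³
  have h1 : |⟪w y, b i⟫| ≤ ‖w y‖ := by
    simpa [b.orthonormal.1] using abs_real_inner_le_norm (w y) (b i)
  have h2 : |⟪w y, b j⟫| ≤ ‖w y‖ := by
    simpa [b.orthonormal.1] using abs_real_inner_le_norm (w y) (b j)
  rw [coordProd, coord, coord, abs_mul, sq]
  exact mul_le_mul h1 h2 (abs_nonneg _) (norm_nonneg _)

/-- **Expansion of the quadratic form:** `D²Φ_ε(z)(w,w) = Σᵢⱼ wᵢwⱼ D²Φ_ε(z)(bᵢ)(bⱼ)`. [folklore] -/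
theorem hessReg_apply_apply_eq_sum (ε : ℝ) (z : ℝ³) (w : ℝ³ → ℝ³) (y : ℝ³) :
    hessReg ε z (w y) (w y) =
      ∑ i, ∑ j, coordProd w i j y * hessReg ε z (stdOrthonormalBasis ℝ ℝ³ i) (stdOrthonormalBasis ℝ ℝ³ j) := by
  set b := stdOrthonormalBasis ℝ ℝ³
  have hw : w y = ∑ i, ⟪w y, b i⟫ • b i := by
    conv_lhs => rw [← b.sum_repr' (w y)]
    exact Finset.sum_congr rfl fun i _ => by rw [real_inner_comm]
  conv_lhs => rw [hw]
  simp only [map_sum, map_smul, FunLike.coe_sum, Finset.sum_apply, FunLike.coe_smul,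
    Pi.smul_apply, smul_eq_mul, Finset.mul_sum]
  refine Finset.sum_congr rfl fun i _ => Finset.sum_congr rfl fun j _ => ?_
  rw [coordProd, coord, coord, hessReg_symm ε z (b j) (b i)]
  ring

/-- **The regularised pressure** `Q_ε[w](x) = -∫ D²Φ_ε(x - y)(w(y), w(y)) dy`. [folklore] -/
def regPressure (ε : ℝ) (w : ℝ³ → ℝ³) (x : ℝ³) : ℝ := -∫ y, hessReg ε (x - y) (w y) (w y)

/-- The integrand of `Q_ε` is continuous with compact support in `y`. [folklore] -/
theorem continuous_hessReg_apply_apply (ε : ℝ) (hw : Continuous w) (x : ℝ³) :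
    Continuous fun y => hessReg ε (x - y) (w y) (w y) :=
  ((((continuous_hessReg ε).comp (continuous_const.sub continuous_id)).clm_apply hw).clm_apply hw)

/-- The integrand of `Q_ε` is integrable in `y`. [folklore] -/
theorem integrable_hessReg_apply_apply (ε : ℝ) (hw : Continuous w) (hwc : HasCompactSupport w) (x : ℝ³) :
    Integrable fun y => hessReg ε (x - y) (w y) (w y) :=
  (continuous_hessReg_apply_apply ε hw x).integrable_of_hasCompactSupport
    (hwc.mono fun y hy => by
      rw [mem_support] at hy ⊢
      contrapose! hy
      simp [hy])

/-- **`Q_ε` through the Hessian convolutions (polarisation):**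
`Q_ε[w] = -½ Σᵢⱼ (H^{bᵢ+bⱼ}_ε[wᵢwⱼ] - H^{bᵢ}_ε[wᵢwⱼ] - H^{bⱼ}_ε[wᵢwⱼ])`. [folklore] -/
theorem regPressure_eq_sum_hessConv (ε : ℝ) (hw : Continuous w) (hwc : HasCompactSupport w) (x : ℝ³) :
    regPressure ε w x =
      -(2⁻¹ * ∑ i, ∑ j,
        (hessConv ε (coordProd w i j) (stdOrthonormalBasis ℝ ℝ³ i + stdOrthonormalBasis ℝ ℝ³ j) x -
          hessConv ε (coordProd w i j) (stdOrthonormalBasis ℝ ℝ³ i) x -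
          hessConv ε (coordProd w i j) (stdOrthonormalBasis ℝ ℝ³ j) x)) := by
  set b := stdOrthonormalBasis ℝ ℝ³
  have hint : ∀ (i j) (u v : ℝ³), Integrable fun y => coordProd w i j y * hessReg ε (x - y) u v :=
    fun i j u v => ((continuous_coordProd hw i j).mul
      ((((continuous_hessReg ε).comp (continuous_const.sub continuous_id)).clm_apply
        continuous_const).clm_apply continuous_const)).integrable_of_hasCompactSupport
      (hasCompactSupport_coordProd hwc i j).mul_right
  -- rewrite `hessConv` with the curried Hessian
  have hH : ∀ (i j) (u : ℝ³), hessConv ε (coordProd w i j) u x =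
      ∫ y, coordProd w i j y * hessReg ε (x - y) u u := by
    intro i j u
    simp only [hessConv, fderiv_fderiv_newtonReg_apply_eq_hessReg]
  -- the left-hand side as a double sum
  have hL : regPressure ε w x = -∑ i, ∑ j, ∫ y, coordProd w i j y * hessReg ε (x - y) (b i) (b j) := by
    rw [regPressure]
    congr 1
    simp_rw [hessReg_apply_apply_eq_sum ε _ w]
    rw [integral_finsetSum _ (fun i _ => integrable_finsetSum _ fun j _ => hint i j (b i) (b j))]
    exact Finset.sum_congr rfl fun i _ => integral_finsetSum _ fun j _ => hint i j (b i) (b j)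
  rw [hL, Finset.mul_sum]
  congr 1
  refine Finset.sum_congr rfl fun i _ => ?_
  rw [Finset.mul_sum]
  refine Finset.sum_congr rfl fun j _ => ?_
  rw [hH, hH, hH]
  have h12 : Integrable fun y => coordProd w i j y * hessReg ε (x - y) (b i + b j) (b i + b j) -
      coordProd w i j y * hessReg ε (x - y) (b i) (b i) := (hint i j _ _).sub (hint i j _ _)
  rw [← integral_sub (hint i j _ _) (hint i j _ _), ← integral_sub h12 (hint i j _ _),
    ← integral_const_mul]
  refine integral_congr_ae (Eventually.of_forall fun y => ?_)
  simp only
  rw [hessReg_polarisation ε (x - y) (b i) (b j)]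
  ring

/-- `Q_ε[w]` is measurable. [folklore] -/
theorem aestronglyMeasurable_regPressure (ε : ℝ) (hw : Continuous w) (hwc : HasCompactSupport w) :
    AEStronglyMeasurable (regPressure ε w) volume := by
  set b := stdOrthonormalBasis ℝ ℝ³
  have hfun : regPressure ε w = fun x => -(2⁻¹ * ∑ i, ∑ j,
      (hessConv ε (coordProd w i j) (b i + b j) x - hessConv ε (coordProd w i j) (b i) x -
        hessConv ε (coordProd w i j) (b j) x)) :=
    funext fun x => regPressure_eq_sum_hessConv ε hw hwc x
  rw [hfun]
  refine (AEStronglyMeasurable.const_mul (Finset.aestronglyMeasurable_fun_sum _ fun i _ =>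
    Finset.aestronglyMeasurable_fun_sum _ fun j _ => ?_) _).neg
  have hm := fun u => aestronglyMeasurable_hessConv ε (continuous_coordProd hw i j) u
  exact ((hm _).sub (hm _)).sub (hm _)

/-- **`L²` bound for the regularised pressure:** `‖Q_ε[w]‖_{L²} ≤ 27 M_λ ‖|w|²‖_{L²}` for
`w ∈ C_c(ℝ³; ℝ³)` (polarisation, `‖H^a_ε[h]‖_{L²} ≤ |a|² M_λ ‖h‖_{L²}`, `|wᵢwⱼ| ≤ |w|²`).
[folklore] -/
theorem eLpNorm_regPressure_le (hε : 0 < ε) (hw : Continuous w) (hwc : HasCompactSupport w) :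
    eLpNorm (regPressure ε w) 2 volume ≤
      ENNReal.ofReal (27 * regLaplacianMass) * eLpNorm (fun y => ‖w y‖ ^ 2) 2 volume := by
  set b := stdOrthonormalBasis ℝ ℝ³
  set N : ℝ≥0∞ := eLpNorm (fun y => ‖w y‖ ^ 2) 2 volume with hN
  set L : ℝ≥0∞ := ENNReal.ofReal regLaplacianMass with hL
  have hfun : regPressure ε w = -((2⁻¹ : ℝ) • fun x => ∑ i, ∑ j,
      (hessConv ε (coordProd w i j) (b i + b j) x - hessConv ε (coordProd w i j) (b i) x -
        hessConv ε (coordProd w i j) (b j) x)) := by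
    funext x
    simp only [Pi.neg_apply, Pi.smul_apply, smul_eq_mul]
    exact regPressure_eq_sum_hessConv ε hw hwc x
  -- the `L²` norm of each `wᵢwⱼ` is at most that of `|w|²`
  have hcp : ∀ i j, eLpNorm (coordProd w i j) 2 volume ≤ N := fun i j =>
    eLpNorm_mono_real fun y => by
      rw [Real.norm_eq_abs]
      exact abs_coordProd_le w i j y
  -- each Hessian convolution
  have hH : ∀ (i j) (u : ℝ³), eLpNorm (hessConv ε (coordProd w i j) u) 2 volume ≤
      ENNReal.ofReal (‖u‖ ^ 2) * (L * N) := fun i j u =>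
    (eLpNorm_hessConv_le hε (continuous_coordProd hw i j) (hasCompactSupport_coordProd hwc i j) u).trans
      (by gcongr; exact hcp i j)
  have hm : ∀ (i j) (u : ℝ³), AEStronglyMeasurable (hessConv ε (coordProd w i j) u) volume :=
    fun i j u => aestronglyMeasurable_hessConv ε (continuous_coordProd hw i j) u
  -- norms of the basis vectors
  have hb1 : ∀ i, ‖b i‖ ^ 2 = 1 := fun i => by rw [b.orthonormal.1, one_pow]
  have hb2 : ∀ i j, ‖b i + b j‖ ^ 2 ≤ 4 := fun i j => by
    calc ‖b i + b j‖ ^ 2 ≤ (‖b i‖ + ‖b j‖) ^ 2 := pow_le_pow_left₀ (norm_nonneg _) (norm_add_le _ _) 2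
      _ = 4 := by rw [b.orthonormal.1, b.orthonormal.1]; norm_num
  -- each `(i, j)` term
  have hterm : ∀ i j, eLpNorm (fun x => hessConv ε (coordProd w i j) (b i + b j) x -
      hessConv ε (coordProd w i j) (b i) x - hessConv ε (coordProd w i j) (b j) x) 2 volume ≤
      ENNReal.ofReal 6 * (L * N) := by
    intro i j
    calc eLpNorm (fun x => hessConv ε (coordProd w i j) (b i + b j) x -
          hessConv ε (coordProd w i j) (b i) x - hessConv ε (coordProd w i j) (b j) x) 2 volume
        ≤ eLpNorm (fun x => hessConv ε (coordProd w i j) (b i + b j) x -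
            hessConv ε (coordProd w i j) (b i) x) 2 volume +
            eLpNorm (hessConv ε (coordProd w i j) (b j)) 2 volume :=
          eLpNorm_sub_le ((hm i j _).sub (hm i j _)) (hm i j _) one_le_two
      _ ≤ (eLpNorm (hessConv ε (coordProd w i j) (b i + b j)) 2 volume +
            eLpNorm (hessConv ε (coordProd w i j) (b i)) 2 volume) +
            eLpNorm (hessConv ε (coordProd w i j) (b j)) 2 volume := by
          gcongr
          exact eLpNorm_sub_le (hm i j _) (hm i j _) one_le_two
      _ ≤ (ENNReal.ofReal (‖b i + b j‖ ^ 2) * (L * N) + ENNReal.ofReal (‖b i‖ ^ 2) * (L * N)) +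
            ENNReal.ofReal (‖b j‖ ^ 2) * (L * N) := by
          gcongr <;> exact hH i j _
      _ ≤ (ENNReal.ofReal 4 * (L * N) + ENNReal.ofReal 1 * (L * N)) + ENNReal.ofReal 1 * (L * N) := by
          gcongr
          · exact hb2 i j
          · exact (hb1 i).le
          · exact (hb1 j).le
      _ = ENNReal.ofReal 6 * (L * N) := by
          rw [← add_mul, ← add_mul, ← ENNReal.ofReal_add (by norm_num) (by norm_num),
            ← ENNReal.ofReal_add (by norm_num) (by norm_num)]
          norm_num
  -- sum and constants
  rw [hfun, eLpNorm_neg, eLpNorm_const_smul]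
  have hsum : eLpNorm (∑ i, ∑ j, fun x => hessConv ε (coordProd w i j) (b i + b j) x -
      hessConv ε (coordProd w i j) (b i) x - hessConv ε (coordProd w i j) (b j) x) 2 volume ≤
      (9 : ℕ) • (ENNReal.ofReal 6 * (L * N)) := by
    calc eLpNorm (∑ i, ∑ j, fun x => hessConv ε (coordProd w i j) (b i + b j) x -
          hessConv ε (coordProd w i j) (b i) x - hessConv ε (coordProd w i j) (b j) x) 2 volume
        ≤ ∑ i, eLpNorm (∑ j, fun x => hessConv ε (coordProd w i j) (b i + b j) x -
            hessConv ε (coordProd w i j) (b i) x - hessConv ε (coordProd w i j) (b j) x) 2 volume :=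
          eLpNorm_sum_le (fun i _ => Finset.aestronglyMeasurable_sum _ fun j _ =>
            ((hm i j _).sub (hm i j _)).sub (hm i j _)) one_le_two
      _ ≤ ∑ i, ∑ j, eLpNorm (fun x => hessConv ε (coordProd w i j) (b i + b j) x -
            hessConv ε (coordProd w i j) (b i) x - hessConv ε (coordProd w i j) (b j) x) 2 volume :=
          Finset.sum_le_sum fun i _ => eLpNorm_sum_le (fun j _ =>
            ((hm i j _).sub (hm i j _)).sub (hm i j _)) one_le_two
      _ ≤ ∑ _i : Fin (Module.finrank ℝ ℝ³), ∑ _j : Fin (Module.finrank ℝ ℝ³), ENNReal.ofReal 6 * (L * N) :=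
          Finset.sum_le_sum fun i _ => Finset.sum_le_sum fun j _ => hterm i j
      _ = (9 : ℕ) • (ENNReal.ofReal 6 * (L * N)) := by
          rw [Finset.sum_const, Finset.sum_const, Finset.card_univ, Fintype.card_fin,
            finrank_euclideanSpace_fin, smul_smul]
          rfl
  have hfun2 : (∑ i, ∑ j, fun x => hessConv ε (coordProd w i j) (b i + b j) x -
      hessConv ε (coordProd w i j) (b i) x - hessConv ε (coordProd w i j) (b j) x) =
      fun x => ∑ i, ∑ j, (hessConv ε (coordProd w i j) (b i + b j) x -
        hessConv ε (coordProd w i j) (b i) x - hessConv ε (coordProd w i j) (b j) x) := by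
    funext x
    simp only [Finset.sum_apply]
  rw [hfun2] at hsum
  calc ‖(2⁻¹ : ℝ)‖ₑ * eLpNorm (fun x => ∑ i, ∑ j, (hessConv ε (coordProd w i j) (b i + b j) x -
        hessConv ε (coordProd w i j) (b i) x - hessConv ε (coordProd w i j) (b j) x)) 2 volume
      ≤ ‖(2⁻¹ : ℝ)‖ₑ * ((9 : ℕ) • (ENNReal.ofReal 6 * (L * N))) := by gcongr
    _ = ENNReal.ofReal (27 * regLaplacianMass) * N := by
        rw [nsmul_eq_mul, hL, Real.enorm_eq_ofReal (by norm_num), ← mul_assoc, ← mul_assoc, ← mul_assoc,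
          show ((9 : ℕ) : ℝ≥0∞) = ENNReal.ofReal 9 by norm_num,
          ← ENNReal.ofReal_mul (by norm_num), ← ENNReal.ofReal_mul (by norm_num),
          ← ENNReal.ofReal_mul (by norm_num)]
        congr 1
        congr 1
        ring

/-! ### `Q_ε` versus the truncated singular integral -/

/-- Off the closed ball: the integrand of `Q_ε` is `-K(x-y)(w(y))`. [folklore] -/
theorem hessReg_apply_apply_eq_neg_pressureKernel (hε : 0 < ε) {x y : ℝ³} (hy : y ∈ (closedBall x ε)ᶜ)
    (c : ℝ³) : hessReg ε (x - y) c c = -pressureKernel (x - y) c := by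
  rw [mem_compl_iff, mem_closedBall, not_le, dist_eq_norm, ← norm_neg, neg_sub] at hy
  rw [← fderiv_fderiv_newtonReg_apply_eq_hessReg, fderiv_fderiv_newtonReg_apply_eq_neg_pressureKernel hε hy]

/-- The frozen-coefficient integral over the ball: `∫_{|x-y|≤ε} D²Φ_ε(x-y)(c,c) dy = |c|²/3`.
[folklore] -/
theorem setIntegral_closedBall_hessReg_const (hε : 0 < ε) (x c : ℝ³) :
    ∫ y in closedBall x ε, hessReg ε (x - y) c c = ‖c‖ ^ 2 / 3 := by
  rw [← integral_indicator measurableSet_closedBall]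
  set F : ℝ³ → ℝ := (closedBall (0 : ℝ³) ε).indicator fun z => hessReg ε z c c with hF
  have hpt : ∀ y, (closedBall x ε).indicator (fun y => hessReg ε (x - y) c c) y = F (x - y) := by
    intro y
    have hiff : y ∈ closedBall x ε ↔ x - y ∈ closedBall (0 : ℝ³) ε := by
      rw [mem_closedBall, mem_closedBall_zero_iff, dist_eq_norm, ← norm_neg, neg_sub]
    by_cases hy : y ∈ closedBall x ε
    · rw [indicator_of_mem hy, hF, indicator_of_mem (hiff.1 hy)]
    · rw [indicator_of_notMem hy, hF, indicator_of_notMem (fun h => hy (hiff.2 h))]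
  calc ∫ y, (closedBall x ε).indicator (fun y => hessReg ε (x - y) c c) y = ∫ y, F (x - y) :=
        integral_congr_ae (Eventually.of_forall hpt)
    _ = ∫ z, F z := integral_sub_left_eq_self F volume x
    _ = ∫ z in closedBall (0 : ℝ³) ε, hessReg ε z c c := integral_indicator measurableSet_closedBall
    _ = ‖c‖ ^ 2 / 3 := by
        simp_rw [← fderiv_fderiv_newtonReg_apply_eq_hessReg]
        exact integral_closedBall_fderiv_fderiv_newtonReg hε c

/-- **`Q_ε` is the truncated singular integral up to the local term and an `O(ε)` error.** For
`w` continuous with compact support, `|w| ≤ M₀`, `|w(y) - w(x)| ≤ M₁|y - x|`, and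
`‖D²Φ_ε‖ ≤ ε⁻³M`:
`|Q_ε[w](x) - (∫_{|x-y|>ε} K(x-y)(w(y)) dy - |w(x)|²/3)| ≤ (8π/3) M M₀ M₁ ε`. [folklore] -/
theorem abs_regPressure_sub_le (hε : 0 < ε) (hw : Continuous w) (hwc : HasCompactSupport w)
    {M M₀ M₁ : ℝ} (hM : ∀ z : ℝ³, ‖hessReg ε z‖ ≤ ε⁻¹ ^ 3 * M) (hM0 : 0 ≤ M)
    (hM₀ : ∀ y, ‖w y‖ ≤ M₀) (hM₁ : ∀ x y, ‖w y - w x‖ ≤ M₁ * ‖y - x‖) (hM₁0 : 0 ≤ M₁) (x : ℝ³) :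
    |regPressure ε w x - (truncatedPressureIntegral w x ε - ‖w x‖ ^ 2 / 3)| ≤
      8 * Real.pi / 3 * M * M₀ * M₁ * ε := by
  set S : Set ℝ³ := closedBall x ε with hS
  have hSm : MeasurableSet S := measurableSet_closedBall
  set k : ℝ³ → ℝ := fun y => hessReg ε (x - y) (w y) (w y) with hk
  set k₀ : ℝ³ → ℝ := fun y => hessReg ε (x - y) (w x) (w x) with hk₀
  have hki : Integrable k := integrable_hessReg_apply_apply ε hw hwc x
  have hk₀c : Continuous k₀ :=
    (((continuous_hessReg ε).comp (continuous_const.sub continuous_id)).clm_apply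
      continuous_const).clm_apply continuous_const
  have hM₀0 : 0 ≤ M₀ := (norm_nonneg _).trans (hM₀ x)
  -- split the integral
  have hsplit : ∫ y, k y = (∫ y in S, k y) + ∫ y in Sᶜ, k y := (integral_add_compl hSm hki).symm
  -- the complement: the truncated singular integral
  have hcompl : ∫ y in Sᶜ, k y = -truncatedPressureIntegral w x ε := by
    rw [truncatedPressureIntegral, ← integral_neg]
    refine setIntegral_congr_fun hSm.compl fun y hy => ?_
    exact hessReg_apply_apply_eq_neg_pressureKernel hε hy (w y)
  -- the ball: frozen coefficients plus an error
  have hkS : IntegrableOn k S := hki.integrableOn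
  have hk₀S : IntegrableOn k₀ S := hk₀c.continuousOn.integrableOn_compact (isCompact_closedBall _ _)
  have hball : ∫ y in S, k y = ‖w x‖ ^ 2 / 3 + ∫ y in S, (k y - k₀ y) := by
    rw [integral_sub hkS hk₀S, setIntegral_closedBall_hessReg_const hε x (w x)]
    ring
  -- the error bound
  have herr : |∫ y in S, (k y - k₀ y)| ≤ 8 * Real.pi / 3 * M * M₀ * M₁ * ε := by
    have hpt : ∀ y ∈ S, |k y - k₀ y| ≤ ε⁻¹ ^ 3 * M * (M₀ + M₀) * (M₁ * ε) := by
      intro y hy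
      have hyx : ‖y - x‖ ≤ ε := by rwa [hS, mem_closedBall, dist_eq_norm] at hy
      have h1 : ‖hessReg ε (x - y)‖ ≤ ε⁻¹ ^ 3 * M := hM _
      have h2 : ‖w x‖ + ‖w y‖ ≤ M₀ + M₀ := add_le_add (hM₀ x) (hM₀ y)
      have h3 : ‖w y - w x‖ ≤ M₁ * ε := (hM₁ x y).trans (mul_le_mul_of_nonneg_left hyx hM₁0)
      calc |k y - k₀ y| ≤ ‖hessReg ε (x - y)‖ * (‖w x‖ + ‖w y‖) * ‖w y - w x‖ :=
            abs_apply_apply_sub_le _ _ _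
        _ ≤ (ε⁻¹ ^ 3 * M) * (M₀ + M₀) * (M₁ * ε) :=
            mul_le_mul (mul_le_mul h1 h2 (by positivity) (by positivity)) h3 (norm_nonneg _)
              (by positivity)
    have hvol : (volume : Measure ℝ³).real S = ε ^ 3 * (4 * Real.pi / 3) := by
      rw [hS, Measure.addHaar_real_closedBall volume x hε.le, finrank_euclideanSpace_fin,
        volume_real_ball_zero_one]
    calc |∫ y in S, (k y - k₀ y)| ≤ ∫ y in S, |k y - k₀ y| := abs_integral_le_integral_abs
      _ ≤ ∫ _ in S, ε⁻¹ ^ 3 * M * (M₀ + M₀) * (M₁ * ε) := by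
          refine setIntegral_mono_on (hkS.sub hk₀S).abs (integrableOn_const (hs := ?_)) hSm hpt
          rw [hS]
          exact (isCompact_closedBall _ _).measure_lt_top.ne
      _ = ε⁻¹ ^ 3 * M * (M₀ + M₀) * (M₁ * ε) * (ε ^ 3 * (4 * Real.pi / 3)) := by
          rw [setIntegral_const, smul_eq_mul, hvol, mul_comm]
      _ = 8 * Real.pi / 3 * M * M₀ * M₁ * ε := by
          field_simp
          ring
  -- assemble
  have hQ : regPressure ε w x - (truncatedPressureIntegral w x ε - ‖w x‖ ^ 2 / 3) =
      -∫ y in S, (k y - k₀ y) := by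
    rw [regPressure, show (∫ y, hessReg ε (x - y) (w y) (w y)) = ∫ y, k y from rfl, hsplit, hcompl,
      hball]
    ring
  rw [hQ, abs_neg]
  exact herr

end RegPressure

/-! ## §5. The limit `ε → 0`: principal values and the `L²` bound -/

section Limit

variable {ε : ℝ} {w : ℝ³ → ℝ³}

/-- **Two integrations by parts:** `H^a_ε[h](x) = ∫ Φ_ε(x - t) ∂ₐ∂ₐh(t) dt` for `h ∈ C²_c`. [folklore] -/
theorem hessConv_eq_integral_newtonReg_mul (ε : ℝ) {h : ℝ³ → ℝ} (hh : ContDiff ℝ 2 h)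
    (hhc : HasCompactSupport h) (a x : ℝ³) :
    hessConv ε h a x = ∫ t, newtonReg ε (x - t) * fderiv ℝ (fun s => fderiv ℝ h s a) t a := by
  rw [hessConv, FluidPDE.integral_comp_sub_mul_fderiv_fderiv_apply (contDiff_newtonReg ε (n := 2)) hh hhc x a]
  exact integral_congr_ae (Eventually.of_forall fun t => mul_comm _ _)

/-- `∫_{|z|<ε} |z|⁻¹ dz ≤ 4πε²` in the form of an integrable radial majorant:
`1_{|z|<ε}|z|⁻¹ ≤ ε · 1_{|z|<ε}|z|⁻²` and `∫ 1_{|z|<ε}|z|⁻² = 4πε`. [folklore] -/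
theorem integral_nearProfile₂_norm_eq (hε : 0 < ε) : ∫ z : ℝ³, nearProfile₂ ε ‖z‖ = 4 * Real.pi * ε := by
  have h := (integral_nearProfile₁_norm_sq (r := ε) hε).2
  simp_rw [← nearProfile₂_eq_sq] at h
  exact h

/-- **`|Φ_ε - Γ| ≤ 1_{|z|<ε} (2π|z|)⁻¹ ≤ (2π)⁻¹ ε · 1_{|z|<ε}|z|⁻²`.** [folklore] -/
theorem abs_newtonReg_sub_newtonKernel_le (hε : 0 < ε) (z : ℝ³) :
    |newtonReg ε z - newtonKernel z| ≤ (2 * Real.pi)⁻¹ * ε * nearProfile₂ ε ‖z‖ := by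
  by_cases hz : ε ≤ ‖z‖
  · rw [newtonReg_eq_newtonKernel hε hz, sub_self, abs_zero]
    exact mul_nonneg (by positivity) (nearProfile₂_nonneg _ _)
  · rw [not_le] at hz
    have h1 : |newtonReg ε z - newtonKernel z| ≤ (4 * Real.pi * ‖z‖)⁻¹ + (4 * Real.pi * ‖z‖)⁻¹ := by
      refine (abs_sub _ _).trans (add_le_add (abs_newtonReg_le hε z) ?_)
      rw [abs_newtonKernel]
    have h2 : (4 * Real.pi * ‖z‖)⁻¹ + (4 * Real.pi * ‖z‖)⁻¹ = (2 * Real.pi)⁻¹ * nearProfile₁ ε ‖z‖ := by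
      rw [nearProfile₁, if_pos hz]
      rcases eq_or_ne ‖z‖ 0 with h0 | h0
      · rw [h0]; simp
      · field_simp; norm_num
    rw [h2] at h1
    refine h1.trans ?_
    rw [mul_assoc]
    exact mul_le_mul_of_nonneg_left (nearProfile₁_le ε (norm_nonneg z)) (by positivity)

/-- An integrable radial majorant for `|Γ|` on balls: `1_{|z|<ρ}(4π|z|)⁻¹ ≤ (4π)⁻¹ ρ 1_{|z|<ρ}|z|⁻²`.
Hence `t ↦ Γ(x - t) g(t)` is integrable for bounded compactly supported measurable `g`. [folklore] -/
theorem integrable_newtonKernel_mul {g : ℝ³ → ℝ} (hg : Continuous g) (hgc : HasCompactSupport g) (x : ℝ³) :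
    Integrable fun t => newtonKernel (x - t) * g t := by
  obtain ⟨R_g, hRg⟩ : ∃ R_g : ℝ, tsupport g ⊆ closedBall (0 : ℝ³) R_g :=
    (hgc.isCompact.isBounded).subset_closedBall 0
  obtain ⟨G, hG⟩ := hg.bounded_above_of_compact_support hgc
  set ρ : ℝ := ‖x‖ + |R_g| + 1 with hρ
  have hρ0 : 0 < ρ := by positivity
  -- majorant `(4π)⁻¹ ρ G · nearProfile₂ ρ ‖x - t‖`
  have hmaj : Integrable fun t : ℝ³ => (4 * Real.pi)⁻¹ * ρ * G * nearProfile₂ ρ ‖x - t‖ :=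
    ((integrable_nearProfile₂_norm hρ0).comp_sub_left x).const_mul _
  refine hmaj.mono' ?_ (Eventually.of_forall fun t => ?_)
  · exact ((measurable_newtonKernel.comp (measurable_const.sub measurable_id)).mul hg.measurable)
      |>.aestronglyMeasurable
  · rw [Real.norm_eq_abs, abs_mul]
    by_cases ht : t ∈ tsupport g
    · have htn : ‖t‖ ≤ R_g := mem_closedBall_zero_iff.1 (hRg ht)
      have hxt : ‖x - t‖ < ρ := by
        calc ‖x - t‖ ≤ ‖x‖ + ‖t‖ := norm_sub_le _ _
          _ ≤ ‖x‖ + |R_g| := by linarith [le_abs_self R_g]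
          _ < ρ := by simp only [hρ]; linarith
      have hK : |newtonKernel (x - t)| ≤ (4 * Real.pi)⁻¹ * ρ * nearProfile₂ ρ ‖x - t‖ := by
        rw [abs_newtonKernel]
        have h1 : (4 * Real.pi * ‖x - t‖)⁻¹ = (4 * Real.pi)⁻¹ * nearProfile₁ ρ ‖x - t‖ := by
          rw [nearProfile₁, if_pos hxt, mul_inv]
        rw [h1, mul_assoc]
        exact mul_le_mul_of_nonneg_left (nearProfile₁_le ρ (norm_nonneg _)) (by positivity)
      have hG0 : 0 ≤ G := (norm_nonneg _).trans (hG t)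
      calc |newtonKernel (x - t)| * |g t| ≤ ((4 * Real.pi)⁻¹ * ρ * nearProfile₂ ρ ‖x - t‖) * G :=
            mul_le_mul hK (Real.norm_eq_abs _ ▸ hG t) (abs_nonneg _)
              (mul_nonneg (by positivity) (nearProfile₂_nonneg _ _))
        _ = (4 * Real.pi)⁻¹ * ρ * G * nearProfile₂ ρ ‖x - t‖ := by ring
    · rw [image_eq_zero_of_notMem_tsupport ht, abs_zero, mul_zero]
      exact mul_nonneg (mul_nonneg (by positivity) ((norm_nonneg _).trans (hG t)))
        (nearProfile₂_nonneg _ _)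

/-- **Convergence of the regularised potentials:** for `g ∈ C_c` and every `x`,
`|∫ Φ_ε(x-t) g(t) dt - ∫ Γ(x-t) g(t) dt| ≤ 2 ‖g‖_∞ ε²`. [folklore] -/
theorem abs_integral_newtonReg_sub_newtonKernel_mul_le (hε : 0 < ε) {g : ℝ³ → ℝ} (hg : Continuous g)
    (hgc : HasCompactSupport g) {G : ℝ} (hG : ∀ t, ‖g t‖ ≤ G) (x : ℝ³) :
    |(∫ t, newtonReg ε (x - t) * g t) - ∫ t, newtonKernel (x - t) * g t| ≤ 2 * G * ε ^ 2 := by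
  have hG0 : 0 ≤ G := (norm_nonneg _).trans (hG x)
  have hi1 : Integrable fun t => newtonReg ε (x - t) * g t :=
    (((contDiff_newtonReg ε (n := 0)).continuous.comp (continuous_const.sub continuous_id)).mul hg)
      |>.integrable_of_hasCompactSupport hgc.mul_left
  have hi2 := integrable_newtonKernel_mul hg hgc x
  rw [← integral_sub hi1 hi2]
  have hmaj : Integrable fun t : ℝ³ => (2 * Real.pi)⁻¹ * ε * G * nearProfile₂ ε ‖x - t‖ :=
    ((integrable_nearProfile₂_norm hε).comp_sub_left x).const_mul _
  calc |∫ t, (newtonReg ε (x - t) * g t - newtonKernel (x - t) * g t)|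
      ≤ ∫ t, |newtonReg ε (x - t) * g t - newtonKernel (x - t) * g t| := abs_integral_le_integral_abs
    _ ≤ ∫ t, (2 * Real.pi)⁻¹ * ε * G * nearProfile₂ ε ‖x - t‖ := by
        refine integral_mono_of_nonneg (Eventually.of_forall fun t => abs_nonneg _) hmaj
          (Eventually.of_forall fun t => ?_)
        simp only
        rw [← sub_mul, abs_mul]
        calc |newtonReg ε (x - t) - newtonKernel (x - t)| * |g t|
            ≤ ((2 * Real.pi)⁻¹ * ε * nearProfile₂ ε ‖x - t‖) * G :=
              mul_le_mul (abs_newtonReg_sub_newtonKernel_le hε _) (Real.norm_eq_abs _ ▸ hG t)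
                (abs_nonneg _) (mul_nonneg (by positivity) (nearProfile₂_nonneg _ _))
          _ = (2 * Real.pi)⁻¹ * ε * G * nearProfile₂ ε ‖x - t‖ := by ring
    _ = (2 * Real.pi)⁻¹ * ε * G * (4 * Real.pi * ε) := by
        rw [integral_const_mul]
        congr 1
        rw [integral_sub_left_eq_self (fun z : ℝ³ => nearProfile₂ ε ‖z‖) volume x]
        exact integral_nearProfile₂_norm_eq hε
    _ = 2 * G * ε ^ 2 := by
        field_simp
        ring

/-- The regularised potential `N_ε[g](x) = ∫ Φ_ε(x-t) g(t) dt` tends to the Newtonian potential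
`∫ Γ(x-t) g(t) dt` as `ε → 0⁺`, for `g ∈ C_c`. [folklore] -/
theorem tendsto_integral_newtonReg_mul {g : ℝ³ → ℝ} (hg : Continuous g) (hgc : HasCompactSupport g)
    (x : ℝ³) :
    Tendsto (fun ε => ∫ t, newtonReg ε (x - t) * g t) (𝓝[>] 0)
      (𝓝 (∫ t, newtonKernel (x - t) * g t)) := by
  obtain ⟨G, hG⟩ := hg.bounded_above_of_compact_support hgc
  have hdiff : Tendsto (fun ε => (∫ t, newtonReg ε (x - t) * g t) - ∫ t, newtonKernel (x - t) * g t)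
      (𝓝[>] 0) (𝓝 0) := by
    refine squeeze_zero_norm' ?_ ?_ (a := fun ε => 2 * G * ε ^ 2)
    · filter_upwards [self_mem_nhdsWithin] with ε hε
      rw [Real.norm_eq_abs]
      exact abs_integral_newtonReg_sub_newtonKernel_mul_le hε hg hgc hG x
    · have : Tendsto (fun ε : ℝ => 2 * G * ε ^ 2) (𝓝 0) (𝓝 (2 * G * 0 ^ 2)) :=
        (continuous_const.mul (continuous_pow 2)).tendsto 0
      rw [zero_pow two_ne_zero, mul_zero] at this
      exact this.mono_left nhdsWithin_le_nhds
  have := hdiff.add_const (∫ t, newtonKernel (x - t) * g t)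
  simpa using this

/-- The limiting Newtonian potentials of the second derivatives of `wᵢwⱼ` and their combination,
the **limiting pressure** `Q₀[w] = lim_{ε→0} Q_ε[w]`. [folklore] -/
def limPressure (w : ℝ³ → ℝ³) (x : ℝ³) : ℝ :=
  -(2⁻¹ * ∑ i, ∑ j,
    ((∫ t, newtonKernel (x - t) * fderiv ℝ (fun s => fderiv ℝ (coordProd w i j) s
        (stdOrthonormalBasis ℝ ℝ³ i + stdOrthonormalBasis ℝ ℝ³ j)) t
        (stdOrthonormalBasis ℝ ℝ³ i + stdOrthonormalBasis ℝ ℝ³ j)) -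
      (∫ t, newtonKernel (x - t) * fderiv ℝ (fun s => fderiv ℝ (coordProd w i j) s
        (stdOrthonormalBasis ℝ ℝ³ i)) t (stdOrthonormalBasis ℝ ℝ³ i)) -
      (∫ t, newtonKernel (x - t) * fderiv ℝ (fun s => fderiv ℝ (coordProd w i j) s
        (stdOrthonormalBasis ℝ ℝ³ j)) t (stdOrthonormalBasis ℝ ℝ³ j))))

/-- The second directional derivatives of `wᵢwⱼ` are continuous with compact support. [folklore] -/
theorem continuous_fderiv_fderiv_coordProd (hw : ContDiff ℝ ∞ w) (i j : Fin (Module.finrank ℝ ℝ³))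
    (a : ℝ³) : Continuous fun t => fderiv ℝ (fun s => fderiv ℝ (coordProd w i j) s a) t a :=
  FluidPDE.continuous_fderiv_fderiv_apply (contDiff_infty.1 (contDiff_coordProd hw i j) 2) a a

/-- The second directional derivatives of `wᵢwⱼ` have compact support. [folklore] -/
theorem hasCompactSupport_fderiv_fderiv_coordProd (hwc : HasCompactSupport w)
    (i j : Fin (Module.finrank ℝ ℝ³)) (a : ℝ³) :
    HasCompactSupport fun t => fderiv ℝ (fun s => fderiv ℝ (coordProd w i j) s a) t a :=
  FluidPDE.hasCompactSupport_fderiv_fderiv_apply (hasCompactSupport_coordProd hwc i j) a a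

/-- **`Q_ε[w](x) → Q₀[w](x)` as `ε → 0⁺`**, for every `x` (`w ∈ C^∞_c`). [folklore] -/
theorem tendsto_regPressure (hw : ContDiff ℝ ∞ w) (hwc : HasCompactSupport w) (x : ℝ³) :
    Tendsto (fun ε => regPressure ε w x) (𝓝[>] 0) (𝓝 (limPressure w x)) := by
  set b := stdOrthonormalBasis ℝ ℝ³
  have hid : ∀ ε, regPressure ε w x = -(2⁻¹ * ∑ i, ∑ j,
      ((∫ t, newtonReg ε (x - t) * fderiv ℝ (fun s => fderiv ℝ (coordProd w i j) s (b i + b j)) t (b i + b j)) -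
        (∫ t, newtonReg ε (x - t) * fderiv ℝ (fun s => fderiv ℝ (coordProd w i j) s (b i)) t (b i)) -
        (∫ t, newtonReg ε (x - t) * fderiv ℝ (fun s => fderiv ℝ (coordProd w i j) s (b j)) t (b j)))) := by
    intro ε
    rw [regPressure_eq_sum_hessConv ε hw.continuous hwc x]
    have h2 : ∀ i j, ContDiff ℝ 2 (coordProd w i j) := fun i j =>
      contDiff_infty.1 (contDiff_coordProd hw i j) 2
    simp only [hessConv_eq_integral_newtonReg_mul ε (h2 _ _) (hasCompactSupport_coordProd hwc _ _)]
    rfl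
  rw [show (fun ε => regPressure ε w x) = _ from funext hid, limPressure]
  have hT : ∀ (i j) (a : ℝ³), Tendsto (fun ε => ∫ t, newtonReg ε (x - t) *
      fderiv ℝ (fun s => fderiv ℝ (coordProd w i j) s a) t a) (𝓝[>] 0)
      (𝓝 (∫ t, newtonKernel (x - t) * fderiv ℝ (fun s => fderiv ℝ (coordProd w i j) s a) t a)) :=
    fun i j a => tendsto_integral_newtonReg_mul (continuous_fderiv_fderiv_coordProd hw i j a)
      (hasCompactSupport_fderiv_fderiv_coordProd hwc i j a) x
  refine Tendsto.neg (Tendsto.const_mul _ (tendsto_finsetSum _ fun i _ =>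
    tendsto_finsetSum _ fun j _ => ?_))
  exact ((hT i j _).sub (hT i j _)).sub (hT i j _)

/-- A `C¹` field with compact support is bounded and Lipschitz. [folklore] -/
theorem exists_bound_and_lipschitz (hw : ContDiff ℝ 1 w) (hwc : HasCompactSupport w) :
    ∃ M₀ M₁ : ℝ, 0 ≤ M₁ ∧ (∀ y, ‖w y‖ ≤ M₀) ∧ ∀ x y, ‖w y - w x‖ ≤ M₁ * ‖y - x‖ := by
  obtain ⟨M₀, hM₀⟩ := hw.continuous.bounded_above_of_compact_support hwc
  obtain ⟨M₁, hM₁⟩ := (hw.continuous_fderiv one_ne_zero).bounded_above_of_compact_support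
    (hwc.fderiv ℝ)
  refine ⟨M₀, max M₁ 0, le_max_right _ _, hM₀, fun x y => ?_⟩
  have hd : ∀ z ∈ (univ : Set ℝ³), DifferentiableAt ℝ w z := fun z _ =>
    hw.differentiable one_ne_zero z
  exact Convex.norm_image_sub_le_of_norm_fderiv_le hd (fun z _ => (hM₁ z).trans (le_max_left _ _))
    convex_univ (mem_univ x) (mem_univ y)

/-- **The truncated singular integrals converge:** `∫_{|x-y|>ε} K(x-y)(w(y)) dy → Q₀[w](x) + |w(x)|²/3`
as `ε → 0⁺`, for `w ∈ C^∞_c` and every `x`. [folklore] -/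
theorem tendsto_truncatedPressureIntegral (hw : ContDiff ℝ ∞ w) (hwc : HasCompactSupport w) (x : ℝ³) :
    Tendsto (truncatedPressureIntegral w x) (𝓝[>] 0) (𝓝 (limPressure w x + ‖w x‖ ^ 2 / 3)) := by
  obtain ⟨M, hM0, hM⟩ := exists_bound_fderiv_fderiv_newtonReg
  obtain ⟨M₀, M₁, hM₁0, hM₀, hM₁⟩ := exists_bound_and_lipschitz
    (hw.of_le (by exact_mod_cast le_top)) hwc
  -- the difference `T_ε - |w x|²/3 - Q_ε` is `O(ε)`
  have hdiff : Tendsto (fun ε => truncatedPressureIntegral w x ε - ‖w x‖ ^ 2 / 3 - regPressure ε w x)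
      (𝓝[>] 0) (𝓝 0) := by
    refine squeeze_zero_norm' ?_ ?_ (a := fun ε => 8 * Real.pi / 3 * M * M₀ * M₁ * ε)
    · filter_upwards [self_mem_nhdsWithin] with ε hε
      rw [Real.norm_eq_abs, ← abs_neg]
      have h := abs_regPressure_sub_le hε hw.continuous hwc (hM ε hε) hM0 hM₀ hM₁ hM₁0 x
      convert h using 2
      ring
    · have : Tendsto (fun ε : ℝ => 8 * Real.pi / 3 * M * M₀ * M₁ * ε) (𝓝 0)
          (𝓝 (8 * Real.pi / 3 * M * M₀ * M₁ * 0)) := (continuous_const.mul continuous_id).tendsto 0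
      rw [mul_zero] at this
      exact this.mono_left nhdsWithin_le_nhds
  have h := (hdiff.add (tendsto_regPressure hw hwc x)).add_const (‖w x‖ ^ 2 / 3)
  rw [zero_add] at h
  refine h.congr fun ε => ?_
  ring

/-- **The principal value exists at every point for `w ∈ C^∞_c`**, with value
`p.v.∫ K(x-y)(w(y)) dy = Q₀[w](x) + |w(x)|²/3` (a by-product: no input from Stein is needed for
compactly supported fields). [folklore] -/
theorem hasPressurePV_of_hasCompactSupport (hw : ContDiff ℝ ∞ w) (hwc : HasCompactSupport w) (x : ℝ³) :
    HasPressurePV w x (limPressure w x + ‖w x‖ ^ 2 / 3) := by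
  refine ⟨?_, tendsto_truncatedPressureIntegral hw hwc x⟩
  filter_upwards [self_mem_nhdsWithin] with ε hε
  -- on `{|x-y| > ε}` the integrand is minus the (continuous, compactly supported) integrand of `Q_ε`
  have hki := integrable_hessReg_apply_apply ε hw.continuous hwc x
  refine (hki.neg.integrableOn (s := (closedBall x ε)ᶜ)).congr_fun (fun y hy => ?_)
    measurableSet_closedBall.compl
  simp only [Pi.neg_apply]
  rw [hessReg_apply_apply_eq_neg_pressureKernel hε hy (w y), neg_neg]

/-- **The normalised pressure of a `C^∞_c` field is the limiting pressure:** `p̃[w] = Q₀[w]`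
pointwise. [folklore] -/
theorem normalisedPressure_eq_limPressure (hw : ContDiff ℝ ∞ w) (hwc : HasCompactSupport w) (x : ℝ³) :
    normalisedPressure w x = limPressure w x := by
  rw [normalisedPressure_eq (hasPressurePV_of_hasCompactSupport hw hwc x), finrank_euclideanSpace_fin]
  push_cast
  ring

/-- `Q₀[w]` is the pointwise limit of `Q_{1/(n+1)}[w]`. [folklore] -/
theorem tendsto_regPressure_nat (hw : ContDiff ℝ ∞ w) (hwc : HasCompactSupport w) (x : ℝ³) :
    Tendsto (fun n : ℕ => regPressure (1 / ((n : ℝ) + 1)) w x) atTop (𝓝 (limPressure w x)) := by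
  refine (tendsto_regPressure hw hwc x).comp ?_
  rw [tendsto_nhdsWithin_iff]
  exact ⟨tendsto_one_div_add_atTop_nhds_zero_nat,
    Eventually.of_forall fun n => mem_Ioi.2 (one_div_pos.2 (Nat.cast_add_one_pos n))⟩

/-- **Measurability of `p̃[w]`** for `w ∈ C^∞_c` (pointwise limit of measurable functions). [folklore] -/
theorem aestronglyMeasurable_normalisedPressure (hw : ContDiff ℝ ∞ w) (hwc : HasCompactSupport w) :
    AEStronglyMeasurable (normalisedPressure w) volume := by
  have hfun : normalisedPressure w = limPressure w := funext (normalisedPressure_eq_limPressure hw hwc)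
  rw [hfun]
  exact aestronglyMeasurable_of_tendsto_ae (atTop : Filter ℕ)
    (fun n : ℕ => aestronglyMeasurable_regPressure (1 / ((n : ℝ) + 1)) hw.continuous hwc)
    (ae_of_all _ fun x => tendsto_regPressure_nat hw hwc x)

/-- **The `L²` bound for `p̃[w]`** (`w ∈ C^∞_c`): `‖p̃[w]‖_{L²} ≤ 27 M_λ ‖|w|²‖_{L²}` (Fatou along
`ε = 1/(n+1)`). [folklore] -/
theorem eLpNorm_normalisedPressure_le (hw : ContDiff ℝ ∞ w) (hwc : HasCompactSupport w) :
    eLpNorm (normalisedPressure w) 2 volume ≤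
      ENNReal.ofReal (27 * regLaplacianMass) * eLpNorm (fun y => ‖w y‖ ^ 2) 2 volume := by
  have hfun : normalisedPressure w = limPressure w := funext (normalisedPressure_eq_limPressure hw hwc)
  rw [hfun]
  set Q : ℕ → ℝ³ → ℝ := fun n => regPressure (1 / ((n : ℝ) + 1)) w with hQ
  set Bd : ℝ≥0∞ := ENNReal.ofReal (27 * regLaplacianMass) * eLpNorm (fun y => ‖w y‖ ^ 2) 2 volume
    with hBd
  have hlim : ∀ x, Tendsto (fun n => ‖Q n x‖ₑ ^ 2) atTop (𝓝 (‖limPressure w x‖ₑ ^ 2)) := by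
    intro x
    have h1 : Tendsto (fun n => ENNReal.ofReal |Q n x|) atTop (𝓝 (ENNReal.ofReal |limPressure w x|)) :=
      ENNReal.tendsto_ofReal (tendsto_regPressure_nat hw hwc x).abs
    simp_rw [Real.enorm_eq_ofReal_abs]
    exact ((ENNReal.continuous_pow 2).tendsto _).comp h1
  have hmeas : ∀ n, AEMeasurable (fun x => ‖Q n x‖ₑ ^ 2) volume := fun n =>
    ((aestronglyMeasurable_regPressure _ hw.continuous hwc).enorm.pow_const 2)
  have hbn : ∀ n, ∫⁻ x, ‖Q n x‖ₑ ^ 2 ≤ Bd ^ 2 := by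
    intro n
    have h1 := eLpNorm_regPressure_le (ε := 1 / ((n : ℝ) + 1)) (one_div_pos.2 (Nat.cast_add_one_pos n))
      hw.continuous hwc
    rw [← FluidPDE.eLpNorm_two_sq_eq_lintegral]
    exact pow_le_pow_left' h1 2
  have hkey : ∫⁻ x, ‖limPressure w x‖ₑ ^ 2 ≤ Bd ^ 2 := by
    calc ∫⁻ x, ‖limPressure w x‖ₑ ^ 2 = ∫⁻ x, liminf (fun n => ‖Q n x‖ₑ ^ 2) atTop :=
          lintegral_congr fun x => ((hlim x).liminf_eq).symm
      _ ≤ liminf (fun n => ∫⁻ x, ‖Q n x‖ₑ ^ 2) atTop := lintegral_liminf_le' hmeas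
      _ ≤ Bd ^ 2 := liminf_le_of_frequently_le' (Eventually.of_forall hbn).frequently
  rw [← FluidPDE.eLpNorm_two_sq_eq_lintegral] at hkey
  exact (ENNReal.pow_right_strictMono two_ne_zero).le_iff_le.1 hkey

/-- **Discharge of `NS.stein1970_normalisedPressure_eLpNorm_le`** (Stein 1970, Ch. II §4.2 Thm 3
for the Riesz-type kernels of the normalised pressure, in the form vendored in
`TaoEnergyLocalisationPressure`): for `w ∈ C^∞_c(ℝ³; ℝ³)`, `p̃[w] ∈ L²` with
`‖p̃[w]‖_{L²} ≤ 27 M_λ ‖|w|²‖_{L²}`, `M_λ = ∫|Δ((1-θ)Γ)|` an absolute constant. Proved here by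
the Newtonian-potential route (regularised kernel, Hessian–Laplacian identity, Young, Fatou),
not by Calderón–Zygmund theory. [cite: Stein1971, Ch. II §4.2 Thm 3] -/
theorem stein1970_normalisedPressure_eLpNorm_le_holds : stein1970_normalisedPressure_eLpNorm_le := by
  refine ⟨27 * regLaplacianMass, mul_nonneg (by norm_num) regLaplacianMass_nonneg, fun w hw hwc => ?_⟩
  have hN : MemLp (fun y => ‖w y‖ ^ 2) 2 volume := by
    have h1 : Continuous fun y => ‖w y‖ ^ 2 := hw.continuous.norm.pow 2
    have h2 : HasCompactSupport fun y => ‖w y‖ ^ 2 :=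
      hwc.norm.comp_left (g := fun t : ℝ => t ^ 2) (by norm_num)
    exact h1.memLp_of_hasCompactSupport h2
  have hle := eLpNorm_normalisedPressure_le hw hwc
  refine ⟨⟨aestronglyMeasurable_normalisedPressure hw hwc, ?_⟩, hle⟩
  exact lt_of_le_of_lt hle (ENNReal.mul_lt_top ENNReal.ofReal_lt_top hN.eLpNorm_lt_top)

/-- **Tao 2011, Lemma 8.1, reduced to Tao's Lemma 4.1 (i) and the existence of principal values.**
With the `L²` bound discharged, the energy bound for finite energy smooth solutions follows from
`NS.tao_pressure_normalisation` and `NS.hasPressurePV_of_contDiff` alone.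
[cite: Tao2011, Lemma 8.1] -/
theorem tao_finite_energy_smooth_energy_bound_of_pv (hP : tao_pressure_normalisation)
    (hPV : hasPressurePV_of_contDiff) : tao_finite_energy_smooth_energy_bound :=
  tao_finite_energy_smooth_energy_bound_of_riesz hP hPV stein1970_normalisedPressure_eLpNorm_le_holds

end Limit

end Literature.Analysis.FluidPDE
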